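import Mathlib
import HarnessLib
import HarnessLib.Audit
import Summits.HubbardSuperconductivity.Statement
import Literature.MathematicalPhysics.QuantumLattice.HubbardFermiLiquid
import Literature.MathematicalPhysics.QuantumLattice.KohnLuttinger
import Summits.HubbardSuperconductivity.HubbardSuperconductivity.Theses.WeakCouplingBCS
import Literature.MathematicalPhysics.QuantumLattice.HubbardBandSectorCountingCounts
import Literature.MathematicalPhysics.QuantumLattice.HubbardTorusTwoPointSmallCoupling
import Summits.HubbardSuperconductivity.HubbardSuperconductivity.Theorems.KLProgrammeKLRegimeSplitGeneric
import Summits.HubbardSuperconductivity.HubbardSuperconductivity.Theorems.KLProgrammeKLRegimeSplitPredicatesV3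
import Summits.HubbardSuperconductivity.HubbardSuperconductivity.Theorems.KLProgrammeKLRegimeSplitGenericV3
import Summits.HubbardSuperconductivity.HubbardSuperconductivity.Theorems.KLProgrammeKLRegimeSplitBundleV7
import Summits.HubbardSuperconductivity.HubbardSuperconductivity.Theorems.KLProgrammeKLRegimeSplitGenericV2
import Summits.HubbardSuperconductivity.HubbardSuperconductivity.Theorems.KLProgrammeKLRegimeVolumeLimitDefs
import Summits.HubbardSuperconductivity.HubbardSuperconductivity.Theorems.KLProgrammeKLRegimeSplitGenericV4
import Summits.HubbardSuperconductivity.HubbardSuperconductivity.Theorems.KLProgrammeKLRegimeSplitBundleV11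
import Summits.HubbardSuperconductivity.HubbardSuperconductivity.Theorems.KLProgrammeKLRegimeSplitBundleV12
import Summits.HubbardSuperconductivity.HubbardSuperconductivity.Theorems.KLProgrammeKLRegimeVolumeLimitExDefs
import Summits.HubbardSuperconductivity.HubbardSuperconductivity.Theorems.KLProgrammeKLRegimeSplitBundleV14
import Summits.HubbardSuperconductivity.HubbardSuperconductivity.Theorems.KLProgrammeKLRegimeSplitBundleV16
import Summits.HubbardSuperconductivity.HubbardSuperconductivity.Theorems.KLProgrammeKLRegimeSplitSlotsV17F
import Summits.HubbardSuperconductivity.HubbardSuperconductivity.Theorems.KLProgrammeKLRegimeSplitSlotsV17F2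
import Summits.HubbardSuperconductivity.HubbardSuperconductivity.Theorems.KLProgrammeKLRegimeSplitGenericV5
import Summits.HubbardSuperconductivity.HubbardSuperconductivity.Theorems.KLProgrammeMuOfDopingWindow
import Summits.HubbardSuperconductivity.HubbardSuperconductivity.Theorems.KLProgrammeKLRegimeRenormFlowV17F2

/-!
Route: KLProgramme

DORMANT since 2026-09-05T01:58:48Z (reconciler: no traction for 5 d (last activity item-evidence-added at 2026-08-31T00:57:30Z); parked, not closed — `ledger route dormant route-HubbardSuperconductivity-KLProgramme --off` to reactivate) — unstaffed, not closed; items shared with open routes are served there. `ledger route dormant <id> --off` reactivates.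

# Route KLProgramme — sign-resolved weak-coupling Fermi liquid down to the Kohn–Luttinger scale at
intermediate filling (rung R2d)

It suffices to show X = K1 ∧ K3, a β-REGIME SPLIT of the rung-R2d leaf `H1TwoPointLimitKLScaleD`
(thermodynamic limit of the equal-time thermal
two-point function of the repulsive square-lattice Hubbard model at dopings δ ∈ [0.10, 0.35], for 0
< U ≤ U₀ and 0 < β ≤ e^{c/U²}). K1 (= DECOMP
C5a, Paper 1): the sign-blind Benfatto–Giuliani–Mastropietro theorem at INTERMEDIATE filling, 0 < β
≤ e^{a/U}. K3 (= DECOMP C1+C3+C4+C5b, Paper 2):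
the same limit in the Kohn–Luttinger regime e^{a/U} ≤ β ≤ e^{c/U²} for EVERY a > 0, where the Cooper
channel must be resolved by sign and D₄ block and
the B1g block is driven by the certified Kohn–Luttinger kernel (support item WcbcsKohnLuttingerB1g
of route WeakCouplingBCS, in the tree). K1 ∧ K3 is
equivalent to the leaf (both directions proved in the planner's Sketch); the split is by technique,
not by logic: K1 needs no sign information, K3
needs nothing but. Spine: HOME/DECOMP.md v5 (cell gate-hubbard-kl), no idea card. Leaf of record
(v5): support item stmt-HubbardSuperconductivity-19419 of route WeakCouplingBCS =
`Summit.HubbardSuperconductivity.HubbardSuperconductivity.Theses.WeakCouplingBCS.H1TwoPointLimitKLScaleD`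
(the rung-R2d theorem-half leaf; D-0061 closes_target).
Lean: `(∃ U₀ a : ℝ, 0 < U₀ ∧ 0 < a ∧ ∀ δ ∈ Set.Icc (0.10 : ℝ) 0.35, ∀ U β : ℝ, 0 < U → U ≤ U₀ → 0 <
β → β ≤ Real.exp (a / U) → ∀ (x y : Literature.Probability.LatticeModels.Site 2) (σ σ' : Fin 2), ∃ S
: ℂ, Filter.Tendsto (fun L : ℕ =>
Literature.MathematicalPhysics.QuantumLattice.hubbardThermalTwoPoint β U
(Literature.MathematicalPhysics.QuantumLattice.chemicalPotentialOfDensity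
(Literature.MathematicalPhysics.QuantumLattice.squareDispersion 1 0) (1 - δ)) L x y σ σ')
Filter.atTop (nhds S)) ∧ (∀ a : ℝ, 0 < a → ∃ U₀ c : ℝ, 0 < U₀ ∧ 0 < c ∧ ∀ δ ∈ Set.Icc (0.10 : ℝ)
0.35, ∀ U β : ℝ, 0 < U → U ≤ U₀ → Real.exp (a / U) ≤ β → β ≤ Real.exp (c / U ^ 2) → ∀ (x y :
Literature.Probability.LatticeModels.Site 2) (σ σ' : Fin 2), ∃ S : ℂ, Filter.Tendsto (fun L : ℕ =>
Literature.MathematicalPhysics.QuantumLattice.hubbardThermalTwoPoint β U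
(Literature.MathematicalPhysics.QuantumLattice.chemicalPotentialOfDensity
(Literature.MathematicalPhysics.QuantumLattice.squareDispersion 1 0) (1 - δ)) L x y σ σ')
Filter.atTop (nhds S))`

## Assembly
Pure logic (sorry-free, planner Sketch-g3.lean `closes`): from K1 take (U₀, a); feed a to K3 to get
(U₀′, c); with U₀ ∧ U₀′ and c, split every
admissible β on β ≤ e^{a/U} (K1's regime) versus e^{a/U} ≤ β ≤ e^{c/U²} (K3's regime). The deciding
theorem is `closes : K1 → K3 → H1TwoPointLimitKLScaleD`
(closes_target = the rung-R2d leaf, D-0061), proved THROUGH the `Assembly` item (`closes h₁ h₃ :=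
(show Assembly from …) h₃ h₁`) so that every declared item is in its cone; the converse `leaf → K1 ∧
K3` is also proved in the Sketch (take a := c / U₀), so the split loses nothing.

CLOSES_TARGET: closes rung R2dH1 of HubbardSuperconductivity: Summit.HubbardSuperconductivity.HubbardSuperconductivity.Theses.WeakCouplingBCS.H1TwoPointLimitKLScaleD (D-0061; not the summit Statement) — the deciding theorem of this route concludes that registered leaf instead of the Statement decl `HubbardSuperconductivity` (class rung: servable and labelled, never counted as concluding the summit Statement).

Rationale: WHY THIS LINE. The leaf is the normal-phase half of crux WcbcsBcsConstruction
(stmt-HubbardSuperconductivity-2010) of route WeakCouplingBCS and the theorem half of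
LADDER-Hubbard rung R2d; its certificate half (the sign and spectral gap of the second-order B1g
Cooper kernel on the window) is ALREADY in the tree
(p402339, p403305, p404299). Mechanism: a sectorised multiscale fermionic expansion
(BenfattoGiulianiMastropietro2006, arXiv:cond-mat/0507686; sector
toolbox in the tree: `HubbardBandSectorCounting*`, `SectorisedEffectiveActionBound`,
`RunningCouplingFlow`) in which the flat running-coupling induction
|λ_h| ≤ 2|U| (which dies at β ≈ e^{1/(ρU)} regardless of sign: barrier `WeakCouplingCeiling`) is
replaced by a SIGN-RESOLVED Cooper-channel flow: the
Landau channels stay O(U) absolutely, the repulsive A1g block saturates, the B1g block obeys a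
Riccati comparison seeded by the certified kernel
(KohnLuttinger1965, RaghuKivelsonScalapino2010) and stays < 1 up to (1−η) of its own onset
e^{1/(a_B1g U²)}. Imported: constructive QFT (Gram/tree bounds,
sectors), self-energy regularity in d = 2 (FST II/III, arXiv:cond-mat/9701073,
arXiv:cond-mat/9705272 — with the umklapp-corner normal form of DECOMP v3
App. C replacing FST's small-density hypothesis A5), finite-temperature Fermi-liquid inversion
(DisertoriRivasseau2000, Salmhofer1998). What no prior
route does: every Hubbard route in the negatives index / Theses either stops at the sign-blind
ceiling or assumes the normal phase; this one proves the
normal phase to the KL scale at a filling where even the sign-blind theorem is not in print (BGM's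
μ-range excludes it).

RANKED CRUXES. #2 KLRegimeTwoPointLimit (crux) — K3 — for every a > 0 there are U₀, c > 0 such that
for δ ∈ [0.10, 0.35], 0 < U ≤ U₀ and e^{a/U} ≤ β ≤ e^{c/U²} the finite-volume equal-time thermal
two-point functions of the square-lattice Hubbard torus at μ(δ) converge as L → ∞ (DECOMP C1
BetaSplit + C3 KLSource + C4 dispersion flow incl. the umklapp-corner lemma + C5b c₀-free engine =
Paper 2). [difficulty: XL] (why it might fail: the sectorised bound of the mixed region T ≪ |k₁+k₂|
≪ √T may not close with Landau couplings O(U) but Cooper B1g coupling O(1) (C1); BGM (3.75)–(3.76)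
tadpole strings may irreducibly cost U|h| (C5b).) [BenfattoGiulianiMastropietro2006,
arXiv:cond-mat/9701073, arXiv:cond-mat/9705272, DisertoriRivasseau2000, RaghuKivelsonScalapino2010,
KohnLuttinger1965]
#3 H10TwoPointLimit (crux) — K1 — there are U₀, a > 0 such that for δ ∈ [0.10, 0.35], 0 < U ≤ U₀ and
0 < β ≤ e^{a/U} the same two-point functions converge as L → ∞: the Benfatto–Giuliani–Mastropietro
theorem (whose published μ-range −4 < μ < −2−√2 excludes the window) at intermediate filling,
sign-blind, momentum conserved modulo 2πℤ² (DECOMP C5a = Paper 1 = H1.0). [difficulty: L] (why it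
might fail: the 6/8-leg sector counting modulo 2πℤ² (arbitrary-offset pair-fibre count) could lose a
power of γ^{−h}, not just |h|, at this filling; the inversion (interacting → free Fermi curve) is
non-perturbatively unsolved in print.) [BenfattoGiulianiMastropietro2006, DisertoriRivasseau2000,
Salmhofer1998, arXiv:2109.02135, arXiv:2303.13628]
#9 MuOfDopingWindow (support) — S0 — the free-band chemical potentials of the doping window lie in
the analysis window: μ(δ) ∈ [−1, −0.15] for δ ∈ [0.10, 0.35] (two certified quadratures of `filling`
+ monotonicity + the `sInf` characterisation). It is the second named stub of BOTH cruxes'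
registered birth skeletons (`H10TwoPointLimit_of : H10TwoPointLimitMu (−1) (−0.15) →
MuOfDopingWindow → K1`, `KLRegimeTwoPointLimit_of : … → K3`, compositions proved), so provers work
in the μ-parametrisation. [difficulty: provable-now] [KohnLuttinger1965]

TWO-LAYER PLAN. K3 ⇐ BetaSplit (C1, over `hubbardEffectiveActionCT` kernels + the Cooper-block
projection D2) → DispersionFlow (C4, with the umklapp-corner lemma) →
EngineGivenFlow (C5b) → K3, filed by `route edit --split KLRegimeTwoPointLimit` once definitions
D1/D2 land (k = 3, depth 1). K1 ⇐ SectorCount2n (the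
arbitrary-offset pair-fibre count on top of the landed `BandSectorCounting` toolbox) →
H10GivenCounting → K1 (k = 2). The block-Riccati comparison
step (DECOMP C2: `∀ E, HubbardKLProgramme.C2OneStep E`, pure operator theory, provable now) is NOT
an item at birth: seat p3 lands it as a Theorems proof
against the Literature decl, and it becomes a named stub of BetaSplit's skeleton at the split.

KILL CRITERIA. Refutation of K1 (a γ-power loss in the 2n-leg sector count modulo 2πℤ² at this
filling) kills K1 AND K3: close `refuted:H10TwoPointLimit`, programme
moves to FKT-style overlapping-loop sectors (new route). Refutation of K3 with K1 standing (the
mixed-region bound provably needs the flat coupling bound):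
pivot to the weaker thesis "Fermi liquid and d-wave dominance over U⁻¹ scales" = K1 plus a
Cooper-flow statement at β ≤ e^{a/U} (route edit, new crux,
leaf not reached — the route would then be re-targeted or retired honestly). The umklapp-corner log
with convexity-REDUCING sign and ≥ 4× the normal-form
coefficient (DECOMP App. C falsified by the week-1 job) caps K3 at e^{c₁/U²}, c₁ below the KL onset:
same pivot. Proved elsewhere: a landed
`bgm_two_point_limit`-type theorem covering μ ∈ [−1, −0.15] moots K1.

NOT DECOMPOSED YET. K3's three children (C1/C4/C5b) until D1 (sectorised effective-action kernels by
leg number at scale h, model-bound) and D2 (D₄-block Cooper projection at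
total momentum 0 mod 2πℤ²) exist as definitions; the constants U₀(δ), c(δ) = (1−η)/a_B1g(δ); the L →
∞ and Matsubara/UV bookkeeping (tree:
`HubbardHighTemperature*`, `HubbardThermalTwoPointMatsubaraLimit`); H1.ii (running couplings) and
H1.iii (density-matched d-wave enhancement,
`H1DWaveEnhancementMatched`) — corollary statements filed after K3's split; t′ ≠ 0.

CHEAPEST FALSIFIER. (1) The week-1 kit job of DECOMP v3 App. A: ∂²_θ Re Σ₂(πT, p_F(θ)) at μ = −0.43,
external θ ∈ {0.0148π, 0.4852π} vs controls {0.1207π, 0.25π}, T = 2⁻⁴…2⁻¹²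
(≤ 10 core-h): the planner's normal form PREDICTS slope +2.06·10⁻³U²(ds/dθ)² log(1/T) at the first
two and no log at the controls; a reducing sign with
≥ 4× that slope falsifies App. C and caps K3. Not run by this seat (no compute). (2) On paper, ½–2
days: the 6- and 8-leg sector count modulo 2πℤ² at
μ = −0.43 (arbitrary-offset pair-fibre count): a γ-power loss kills K1.

NUMBERS. Certified (CERT-TABLE, referee PASS): a_B1g(δ) = 0.0105 / 0.0050 / 0.0024 / 0.0015 at δ =
0.10 / 0.20 / 0.30 / 0.35 ⇒ KL onset log(1/T) = 1/a_B1g ≈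
95 / 200 / 417 / 667 (units U⁻²); certified B1g gap γ = 0.0834 (δ = 0.10), 0.0131 (δ = 0.20); μ(δ) =
−0.17983 (0.10), −0.42669 (0.20), −0.885 (0.35).
Umklapp-corner normal form (DECOMP v3 App. C): B = 1/(32√3π³κ(p₁)v(p₁)); curvature change at the KL
onset δκ(k*) = +0.20 / +0.32 / +0.42 vs κ₀(k*) =
1.98 / 1.47 / 0.545 at δ = 0.10 / 0.20 / 0.35; c₁ (scales to flatten if the sign were reducing) =
927 / 909 / 864 > 1/a_B1g. BGM's published regime:
−4 < μ < −2−√2 (tree `bgm_two_point_limit`), i.e. density < 0.19; the window has density 0.65–0.90.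
Items at open: 4 (assembly, 2 cruxes, 1 support).

DEFINITION REQUESTS. D1 `SectorisedLegKernels` (model-bound: the 2n-leg kernels of
`hubbardEffectiveActionCT L M β U μ h Λ` with their sector norms, by leg number) — topic
Summits/HubbardSuperconductivity/HubbardSuperconductivity/Theorems, for KLRegimeTwoPointLimit; D2
`CooperBlockProjection` (D₄-irrep blocks of the 4-leg
kernel at total momentum 0 mod 2πℤ² as bounded self-adjoint operators on L²(F_μ, ds/|∇ε|), the space
of `kohnLuttingerKernel`'s certificate) — same topic,
for KLRegimeTwoPointLimit; D3 `thermalPairSusceptibility` lands with the leaf file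
(HubbardKLProgramme.lean). Cite facts wanted: none new (FST II/III and
DR 2000 are used as METHODS inside proofs, not as hypotheses).

Novelty: Novelty (gen-6 V16 = V14 with the DEGREE-CAPPED frame class `FrameOKDeg` (Nyquist: cap < L/2) in
every generic binder AND the (E3c) comparison binder — Δ25 (repairs the lattice-invisible-frame
defeat F2 of (E3c)₀) + riders MS-Q / E3f-AT ((R18)) / R-Dq; all else byte-identical; no new claim;
record LIT-NOVELTY-R2d.md v5, T2 role file 610cf8562e270501). GRADE/DELTA: K1 = re-proof / first
formalisation of the announced, thesis-proved sign-blind T>0 Fermi-liquid theorem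
(PedraSalmhofer2005ICMP Thm p.4; Pedra2005Thesis) umklapp corners explicit; K3 = NEW — first attack
on the NAMED OPEN problem PS03 Rem. 5 eq. (7) «λ² log(βε₀) < c» for an EXTENDED Fermi curve:
sign/D₄-resolved Cooper flow fed non-perturbatively at T > 0 on the lattice against a
kernel-certified O(U²) B₁g datum; CERTIFICATE HALF = theorem modulo certified computation
(enclosures `klCertB1gD010.EnclosuresB1g`, referee-replayed); not ODLRO, not T_c, stops strictly
above the B₁g onset. PER-CHILD (T2 r2): named-open in print 2/5 (Counterterm = non-perturbative
counterterm inversion; BetaSplit = PS03 Rem. 4 «ladder analysis not done»); Engine = unnamed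
sub-step of PS03 (7) (BGM06 Thm 2.1's role; its (E2)/(E3) outputs unprinted); VolumeLimit = ROUTINE
IN PRINT (Salmhofer 1999 Lemma B.27; BGM06 Rem. after Thm 2.1); Assembly routine; known ≥ S: 0/5.
V11 vs V7: the same five pieces re-typed (Δ16 leg count in t = √(k₀²+ξ²), Δ17 regime threshold ∃c₃
∀c ≤ c₃, Δ18 (E3g), Δ19 n = 0 UV leg term, Δ20 (E3a-MS)); V12 = V11 + Δ21 sig  [refs: 2303.13628, paper:url-421309f0fec9, book:salmhofer1999, BenfattoGiulianiMastropietro2006, DisertoriRivasseau2000, Mastropietro2005, FeldmanKnorrerSinclairTrubowitz1997, RaghuKivelsonScalapino2010]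

Barriers (technique_class: constructive-fermionic-RG, sign-resolved-cooper-flow): - technique_class: constructive-fermionic-RG, sign-resolved-cooper-flow
- Literature.Barriers.HubbardSuperconductivity.WeakCouplingCeiling: OUTSIDE its class — the ceiling
(`summable_cooperChain_neg_iff`, `tendsto_cooperLadder_bubble`) quantifies over sign-blind
coupling-norm inductions, which die at e^{1/(ρU)}; K3 resolves the Cooper block by sign and stops at
(1−η) of the first ATTRACTIVE channel's onset e^{1/(a_B1g U²)} — exactly the narrowing
`WeakCouplingCeilingNarrow` says is the true ceiling; the route never claims to cross the B1g onset
(that is WeakCouplingBCS's SSB crux).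
- Literature.Barriers.HubbardSuperconductivity.DegreeFourSosMissesSecondOrderPerturbation: not
applicable — no SOS/moment relaxation is used; the second-order kernel enters through a
kernel-checked interval certificate (p403305/p404299), not through a degree-4 pseudo-expectation.
- Negatives index: the refuted Hubbard statements (AposterioriCapRg-type a-posteriori caps,
ThermalWedge variants) concern sign-blind caps or T = 0 claims; K1/K3 are T > 0 normal-phase limits
stated on the free-band μ(δ), equal to none of them (BC4 dedup to be re-run at open).

History (route lifecycle, newest last):
- 2026-09-05T01:58:48Z · DORMANT — reconciler: no traction for 5 d (last activity item-evidence-added at 2026-08-31T00:57:30Z); parked, not closed — `ledger route dormant route-HubbardSuperconduc (operator:999:1002056)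

sub-problem: HubbardSuperconductivity · status: dormant · opened planner-gate-hubbard-kl-plan-g6-0 2026-08-25T23:09:44Z · rev 24 · ledger route-HubbardSuperconductivity-KLProgramme
GENERATED by the gate from the ledger (D-0016/17). Provers cite these decls: `theorem foo : Summit.HubbardSuperconductivity.HubbardSuperconductivity.Theses.KLProgramme.<Decl> := …` in Summits/HubbardSuperconductivity/HubbardSuperconductivity/Theorems/<Name>.lean.
-/

namespace Summit.HubbardSuperconductivity.HubbardSuperconductivity.Theses.KLProgramme

open scoped BigOperators Topology Manifold Classical MeasureTheory ProbabilityTheory Matrix InnerProductSpace ComplexConjugate ContinuousMap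
open Filter Set Function TopologicalSpace MeasureTheory

attribute [summit_statement] _root_.HubbardSuperconductivity
attribute [summit_statement] _root_.Summit.HubbardSuperconductivity.HubbardSuperconductivity.Theses.WeakCouplingBCS.H1TwoPointLimitKLScaleD

open Literature.Hubbard

/-! Retired items kept as plain definitions (history; not obligations of this route): landed proofs / closed glue still name them. -/

/-- retired stmt-HubbardSuperconductivity-19634 (retired, gen 1) — named by an active item. -/
def KLRegimeEngine : Prop :=
  Summit.HubbardSuperconductivity.HubbardSuperconductivity.Theorems.KLRegimeSplit.EngineP Summit.HubbardSuperconductivity.HubbardSuperconductivity.Theorems.KLRegimeSplit.klPredsV3 Summit.HubbardSuperconductivity.HubbardSuperconductivity.Theorems.KLRegimeSplit.klWindowC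

/-- retired stmt-HubbardSuperconductivity-19635 (retired, gen 1) — named by an active item. -/
def KLRegimeBetaSplit : Prop :=
  Summit.HubbardSuperconductivity.HubbardSuperconductivity.Theorems.KLRegimeSplit.BetaSplitP Summit.HubbardSuperconductivity.HubbardSuperconductivity.Theorems.KLRegimeSplit.klPredsV3 Summit.HubbardSuperconductivity.HubbardSuperconductivity.Theorems.KLRegimeSplit.klWindowC

/-- retired stmt-HubbardSuperconductivity-19636 (retired, gen 1) — named by an active item. -/
def KLRegimeCounterterm : Prop :=
  Summit.HubbardSuperconductivity.HubbardSuperconductivity.Theorems.KLRegimeSplit.CountertermP Summit.HubbardSuperconductivity.HubbardSuperconductivity.Theorems.KLRegimeSplit.klPredsV3 Summit.HubbardSuperconductivity.HubbardSuperconductivity.Theorems.KLRegimeSplit.klWindowC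

/-- retired stmt-HubbardSuperconductivity-19637 (retired, gen 1) — named by an active item. -/
def KLRegimeTwoPointAssembly : Prop :=
  Summit.HubbardSuperconductivity.HubbardSuperconductivity.Theorems.KLRegimeSplit.TwoPointAssemblyP Summit.HubbardSuperconductivity.HubbardSuperconductivity.Theorems.KLRegimeSplit.klPredsV3 Summit.HubbardSuperconductivity.HubbardSuperconductivity.Theorems.KLRegimeSplit.klWindowC

/-- retired stmt-HubbardSuperconductivity-19662 (retired, gen 2) — named by an active item. -/
def KLRegimeEngineV7 : Prop :=
  Summit.HubbardSuperconductivity.HubbardSuperconductivity.Theorems.KLRegimeSplit.EngineP3 Summit.HubbardSuperconductivity.HubbardSuperconductivity.Theorems.KLRegimeSplit.klPredsV7 Summit.HubbardSuperconductivity.HubbardSuperconductivity.Theorems.KLRegimeSplit.klWindowC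

/-- retired stmt-HubbardSuperconductivity-19664 (retired, gen 2) — named by an active item. -/
def KLRegimeCountertermV7 : Prop :=
  Summit.HubbardSuperconductivity.HubbardSuperconductivity.Theorems.KLRegimeSplit.CountertermP2 Summit.HubbardSuperconductivity.HubbardSuperconductivity.Theorems.KLRegimeSplit.klPredsV7 Summit.HubbardSuperconductivity.HubbardSuperconductivity.Theorems.KLRegimeSplit.klWindowC

/-- retired stmt-HubbardSuperconductivity-19665 (retired, gen 2) — named by an active item. -/
def KLRegimeVolumeLimitV7 : Prop :=
  Summit.HubbardSuperconductivity.HubbardSuperconductivity.Theorems.KLRegimeSplit.VolumeLimitP Summit.HubbardSuperconductivity.HubbardSuperconductivity.Theorems.KLRegimeSplit.klPredsV7 Summit.HubbardSuperconductivity.HubbardSuperconductivity.Theorems.KLRegimeSplit.FinalTwoLegVolLimit Summit.HubbardSuperconductivity.HubbardSuperconductivity.Theorems.KLRegimeSplit.klWindowC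

/-- retired stmt-HubbardSuperconductivity-19823 (retired, gen 3) — named by an active item. -/
def KLRegimeEngineV11 : Prop :=
  Summit.HubbardSuperconductivity.HubbardSuperconductivity.Theorems.KLRegimeSplit.EngineP4 Summit.HubbardSuperconductivity.HubbardSuperconductivity.Theorems.KLRegimeSplit.klPredsV11 Summit.HubbardSuperconductivity.HubbardSuperconductivity.Theorems.KLRegimeSplit.klWindowC

/-- retired stmt-HubbardSuperconductivity-19826 (retired, gen 3) — named by an active item. -/
def KLRegimeVolumeLimitV11 : Prop :=
  Summit.HubbardSuperconductivity.HubbardSuperconductivity.Theorems.KLRegimeSplit.VolumeLimitP2 Summit.HubbardSuperconductivity.HubbardSuperconductivity.Theorems.KLRegimeSplit.klPredsV11 Summit.HubbardSuperconductivity.HubbardSuperconductivity.Theorems.KLRegimeSplit.FinalTwoLegVolLimit Summit.HubbardSuperconductivity.HubbardSuperconductivity.Theorems.KLRegimeSplit.klWindowC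

/-- retired stmt-HubbardSuperconductivity-19855 (retired, gen 4) — named by an active item. -/
def KLRegimeEngineV12 : Prop :=
  Summit.HubbardSuperconductivity.HubbardSuperconductivity.Theorems.KLRegimeSplit.EngineP4 Summit.HubbardSuperconductivity.HubbardSuperconductivity.Theorems.KLRegimeSplit.klPredsV12 Summit.HubbardSuperconductivity.HubbardSuperconductivity.Theorems.KLRegimeSplit.klWindowC

/-- retired stmt-HubbardSuperconductivity-19858 (retired, gen 4) — named by an active item. -/
def KLRegimeVolumeLimitV12 : Prop :=
  Summit.HubbardSuperconductivity.HubbardSuperconductivity.Theorems.KLRegimeSplit.VolumeLimitP2 Summit.HubbardSuperconductivity.HubbardSuperconductivity.Theorems.KLRegimeSplit.klPredsV12 Summit.HubbardSuperconductivity.HubbardSuperconductivity.Theorems.KLRegimeSplit.FinalTwoLegVolLimitEx Summit.HubbardSuperconductivity.HubbardSuperconductivity.Theorems.KLRegimeSplit.klWindowC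

/-- retired stmt-HubbardSuperconductivity-19918 (retired, gen 5) — named by an active item. -/
def KLRegimeEngineV14 : Prop :=
  Summit.HubbardSuperconductivity.HubbardSuperconductivity.Theorems.KLRegimeSplit.EngineP4 Summit.HubbardSuperconductivity.HubbardSuperconductivity.Theorems.KLRegimeSplit.klPredsV14 Summit.HubbardSuperconductivity.HubbardSuperconductivity.Theorems.KLRegimeSplit.klWindowC

/-- retired stmt-HubbardSuperconductivity-19921 (retired, gen 5) — named by an active item. -/
def KLRegimeVolumeLimitV14 : Prop :=
  Summit.HubbardSuperconductivity.HubbardSuperconductivity.Theorems.KLRegimeSplit.VolumeLimitP2 Summit.HubbardSuperconductivity.HubbardSuperconductivity.Theorems.KLRegimeSplit.klPredsV14 Summit.HubbardSuperconductivity.HubbardSuperconductivity.Theorems.KLRegimeSplit.FinalTwoLegVolLimitEx Summit.HubbardSuperconductivity.HubbardSuperconductivity.Theorems.KLRegimeSplit.klWindowC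

/-- retired stmt-HubbardSuperconductivity-20236 (retired, gen 6) — named by an active item. -/
def KLRegimeEngineV16 : Prop :=
  Summit.HubbardSuperconductivity.HubbardSuperconductivity.Theorems.KLRegimeSplit.EngineP4 Summit.HubbardSuperconductivity.HubbardSuperconductivity.Theorems.KLRegimeSplit.klPredsV16 Summit.HubbardSuperconductivity.HubbardSuperconductivity.Theorems.KLRegimeSplit.klWindowC

/-- retired stmt-HubbardSuperconductivity-20239 (retired, gen 6) — named by an active item. -/
def KLRegimeVolumeLimitV16 : Prop :=
  Summit.HubbardSuperconductivity.HubbardSuperconductivity.Theorems.KLRegimeSplit.VolumeLimitP2 Summit.HubbardSuperconductivity.HubbardSuperconductivity.Theorems.KLRegimeSplit.klPredsV16 Summit.HubbardSuperconductivity.HubbardSuperconductivity.Theorems.KLRegimeSplit.FinalTwoLegVolLimitEx Summit.HubbardSuperconductivity.HubbardSuperconductivity.Theorems.KLRegimeSplit.klWindowC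

/-- item stmt-HubbardSuperconductivity-19937 · crux · rank 2 · SPLIT (gen 8) into KLRegimeEngineV17F2, KLRegimeBetaSplitV17F2, KLRegimeRenormFlowV17F2, KLRegimeVolumeLimitV17F2, KLRegimeTwoPointAssemblyV17F2 + glue KLRegimeTwoPointLimitGlueV17F2 · direct attempts still welcome (low priority) · by planner
why it might fail: For c ≤ c₀ every running Cooper block stays O(U) (small-c finding): the crux is a scale-SUMMABLE gain for the non-ladder remainder with momenta conserved only mod 2πℤ² incl. corner classes (E5D/U7), plus an L-uniform fixed point for the counterterm K at |h| ≍ c/U² (tangential loss, KT-S2).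
sources: BenfattoGiulianiMastropietro2006, arXiv:cond-mat/9701073, arXiv:cond-mat/9705272, DisertoriRivasseau2000, RaghuKivelsonScalapino2010, KohnLuttinger1965
earlier split gen 5: KLRegimeEngineV14, KLRegimeBetaSplitV14, KLRegimeCountertermV14, KLRegimeVolumeLimitV14, KLRegimeTwoPointAssemblyV14 — retired stmt-HubbardSuperconductivity-19918, stmt-HubbardSuperconductivity-19921
earlier split gen 6: KLRegimeEngineV16, KLRegimeBetaSplitV16, KLRegimeCountertermV16, KLRegimeVolumeLimitV16, KLRegimeTwoPointAssemblyV16 — retired stmt-HubbardSuperconductivity-20236, stmt-HubbardSuperconductivity-20239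
earlier split gen 7: KLRegimeEngineV17F, KLRegimeBetaSplitV17F, KLRegimeRenormFlowV17F, KLRegimeVolumeLimitV17F, KLRegimeTwoPointAssemblyV17F — retired stmt-HubbardSuperconductivity-20368, stmt-HubbardSuperconductivity-20369, stmt-HubbardSuperconductivity-20370, stmt-HubbardSuperconductivity-20371, stmt-HubbardSuperconductivity-20373
retired/moot children: KLRegimeEngine [retired: Summit.HubbardSuperconductivity.HubbardSuperconductivity.Theorems.KLRegimeSplit.]; KLRegimeBetaSplit [retired: Summit.HubbardSuperconductivity.HubbardSuperconductivity.Theorems.KLRegimeSplit.]; KLRegimeCounterterm [retired: Summit.HubbardSuperconductivity.HubbardSuperconductivity.Theorems.KLRegimeSplit.]; KLRegimeTwoPointAssembly [retired: Summit.HubbardSuperconductivity.HubbardSuperconductivity.Theorems.KLRegimeSplit.]; KLRegimeEngineV7 [retired: Summit.HubbardSuperconductivity.HubbardSuperconductivity.Theorems.KLRegimeSplit.]; KLRegimeCountertermV7 [retired: Summit.HubbardSuperconductivity.HubbardSuperconductivity.Theorems.KLRegimeSplit.]; KLRegimeVolumeLimitV7 [retired: Summit.HubbardSuperconductivity.HubbardSuperconductivity.Theorems.KLRegimeSplit.];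 KLRegimeEngineV11 [retired: Summit.HubbardSuperconductivity.HubbardSuperconductivity.Theorems.KLRegimeSplit.]
[crux] K3 — for every a > 0 there are U₀, c > 0 such that for δ ∈ [0.10, 0.35], 0 < U ≤ U₀ and
e^{a/U} ≤ β ≤ e^{c/U²} the finite-volume equal-time thermal two-point functions of the
square-lattice Hubbard torus at μ(δ) converge as L → ∞ (DECOMP C1 BetaSplit + C3 KLSource + C4
dispersion flow incl. the umklapp-corner lemma + C5b c₀-free engine = Paper 2). [difficulty: XL] -/
@[route_item "route-HubbardSuperconductivity-KLProgramme"]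
def KLRegimeTwoPointLimit : Prop :=
  ∀ a : ℝ, 0 < a → ∃ U₀ c : ℝ, 0 < U₀ ∧ 0 < c ∧ ∀ δ ∈ Set.Icc (0.10 : ℝ) 0.35, ∀ U β : ℝ, 0 < U → U ≤ U₀ → Real.exp (a / U) ≤ β → β ≤ Real.exp (c / U ^ 2) → ∀ (x y : Literature.Probability.LatticeModels.Site 2) (σ σ' : Fin 2), ∃ S : ℂ, Filter.Tendsto (fun L : ℕ => Literature.MathematicalPhysics.QuantumLattice.hubbardThermalTwoPoint β U (Literature.MathematicalPhysics.QuantumLattice.chemicalPotentialOfDensity (Literature.MathematicalPhysics.QuantumLattice.squareDispersion 1 0) (1 - δ)) L x y σ σ') Filter.atTop (nhds S)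

-- parent: KLRegimeTwoPointLimit · child (gen 1)
/--     item stmt-HubbardSuperconductivity-19638 · aside · rank 205 · closed · proved by Summit.HubbardSuperconductivity.HubbardSuperconductivity.Theorems.klRegimeTwoPointLimitGlue_proof (prover)
    parent: KLRegimeTwoPointLimit · by planner
KLRegimeEngine → KLRegimeBetaSplit → KLRegimeCounterterm → KLRegimeTwoPointAssembly →
KLRegimeTwoPointLimit (proved downstream:
Summit.HubbardSuperconductivity.HubbardSuperconductivity.Theorems.KLRegimeSplit.KLRegimeInductionV3,
p443267; 1-line closer to be landed in a Theorems module) -/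
@[route_item "route-HubbardSuperconductivity-KLProgramme"]
def KLRegimeTwoPointLimitGlue : Prop :=
  KLRegimeEngine → KLRegimeBetaSplit → KLRegimeCounterterm → KLRegimeTwoPointAssembly → KLRegimeTwoPointLimit

-- `KLRegimeTwoPointLimitGlue` holds: proved by `Summit.HubbardSuperconductivity.HubbardSuperconductivity.Theorems.klRegimeTwoPointLimitGlue_proof` (its module imports this route file, so no `_holds` link can be stated here).

-- parent: KLRegimeTwoPointLimit · child (gen 2)
/--     item stmt-HubbardSuperconductivity-19663 · crux · rank 202 · closed · proved by Summit.HubbardSuperconductivity.HubbardSuperconductivity.Theorems.klRegimeBetaSplitV7_proof (prover)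
    parent: KLRegimeTwoPointLimit · by operator
    why it might fail: A mis-identified O(U²)-per-scale piece in a D₄ block — transport between sector carriers (ENGINE-PRED §7(c)), one-sector DOS anisotropy, the Wick offset counted per step, the κ₀·Q.CR·Klam³ leg term — crosses the 2(a_Γ+C_Σ)U² Riccati envelope after O(1) ≪ n_β scales; κ₀ = 4000 may be too small.
    sources: HOME/DECOMP.md App. E (E.1–E.5), HOME/prover-p1b/BETASPLIT-PRED.md, arXiv:cond-mat/0507686 §3 (3.65)–(3.70), arXiv:math-ph/0209046 §VI, FeldmanTrubowitz1991Flow Thm V.1, (1.55), Theorems/KLProgrammeCooperChannelRiccatiFlowBlock.lean blockFlow_envelopes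
[crux] child 1 — the SIGN-RESOLVED BETA SPLIT as ONE strong-induction step (DECOMP Lemma E.4): ∀ G,
∃ P, ∀ Q, ∃ c₀ > 0 (where β ≤ e^{c/U²} is spent: no onset, (A₀+Ē)·B̄_n < 1), ∀ c ≤ c₀ ∀ R, ∃ U₀ L₁
M₁: in the regime on klWindowC, for every admissible frame, L ≥ L₁ β U, M ≥ M₁ β U L and every n in
the generic range: `HistP
Summit.HubbardSuperconductivity.HubbardSuperconductivity.Theorems.KLRegimeSplit.klPredsV7` n +
`EngineBoundsAtV5S` at n + `TwoLegStepV7` at n ⟹ `BetaSplitAtS2` (pair-array tolerance `(P.C_W +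
klLegKappa·Q.CR·P.Klam³)·U²`, Δ15: the leg-dressing constant is Q-staged, child 1 uses Q.CR and
never dominates it) at n := `PairArrayAtV2` ((B1) Cooper blocks of the localised quartic part inside
C2's Riccati envelopes — `attractiveEnvelope_step`/`repulsiveEnvelope_step` applied to the (E2)
ladder step; Sherman–Morrison/Neumann resummation of the Cooper amplitude ARRAY in the weighted
max-entry norm, sign lever = U > 0 in the s-wave denominator — `…CooperResummationOffdiag`,
`…CooperResummationWeighted`, `…ChildOneClosersS`) ∧ `EndpointLineS` ((B2) endpoint VALUE line on
the spin-(0,1) line, (S)) ∧ `FirstMoments` ((B4)); (B3) non-Cooper tuples frozen = (E2′) summed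
against -/
@[route_item "route-HubbardSuperconductivity-KLProgramme"]
def KLRegimeBetaSplitV7 : Prop :=
  Summit.HubbardSuperconductivity.HubbardSuperconductivity.Theorems.KLRegimeSplit.BetaSplitP Summit.HubbardSuperconductivity.HubbardSuperconductivity.Theorems.KLRegimeSplit.klPredsV7 Summit.HubbardSuperconductivity.HubbardSuperconductivity.Theorems.KLRegimeSplit.klWindowC

-- `KLRegimeBetaSplitV7` holds: proved by `Summit.HubbardSuperconductivity.HubbardSuperconductivity.Theorems.klRegimeBetaSplitV7_proof` (its module imports this route file, so no `_holds` link can be stated here).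

-- parent: KLRegimeTwoPointLimit · child (gen 2)
/--     item stmt-HubbardSuperconductivity-19666 · crux · rank 205 · closed · proved by Summit.HubbardSuperconductivity.HubbardSuperconductivity.Theorems.TwoPointAssembly.KLRegimeTwoPointAssemblyV7_of (prover)
    parent: KLRegimeTwoPointLimit · by operator
    why it might fail: The (C,V) ↔ (C_K,V_K) covariance change is in the tree only at the Berezin level, not for gaussConv/effAction; the source shift needs exactly index nScales β + 1; t2's all-U Matsubara bound must be L-uniform enough for FinalTwoLegVolLimit's ε–L₁–M₁ order; free-part mismatch ν vs ν + U/2 leaves O(U).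
    sources: arXiv:cond-mat/0507686 §2.4, Lemmas 2.4–2.5, Literature/MathematicalPhysics/QuantumLattice/FermiRG/BGM2006Sec2TwoPoint.lean (Lemma24, Lemma25), Literature/MathematicalPhysics/QuantumLattice/HubbardTwoPointMatsubaraLimit.lean, HOME/t2/MATSUBARA-ALLU-SCOPE.md, Theorems/KLProgrammeKLRegimeTwoPointAssemblyGrassmannRepr.lean (p447372, gaussExpect_gen_mul_gen_mul), HOME/hubbard-kl-r2d-p2/SKELETON-asm-repr.lean (stub_asm_matsubara/partition/frame/repr/volume)
[crux] child 4 — TWO-POINT ASSEMBLY in one frame (BGM 2006 §2.4 / Lemma 2.5's role; Δ-asm-repaired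
`TwoPointAssemblyP3`, hypothesis block `TowerP`): ∀ G P Q R ∀ c > 0 ∃ U₀: in the regime at (ν,U,β),
IF ONE admissible frame K (fixed before the volume) is renormalised, split, engine-bounded and
two-leg-controlled at every scale n ≤ nScales β + 1 (R1: the last slice is fully integrated) for all
L ≥ L⋆, M ≥ M⋆ L AND `FinalTwoLegVolLimit β U ν K M⋆` holds for THE SAME K (child 5's output, inside
the ∃K hypothesis), THEN the finite-volume equal-time thermal two-point functions
`hubbardThermalTwoPoint β U (ν + U/2) L x y σ σ'` (physical μ = ν + U/2, Hartree shift Δ5) converge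
as L → ∞: Matsubara UV M → ∞ for every real U (t2:
`tendsto_grassmannTwoPoint_eq_hubbardThermalTwoPoint_sub_allU` line, `stub_asm_matsubara`) +
Gaussian change of covariance (C,V) ↔ (C_K,V_K) (`GrassmannGaussianMeasureChange`, `stub_asm_frame`)
+ source-shift representation G = C_K − C_K·𝒱₂·C_K (`GrassmannGaussianSourceShift`, landed
`gaussExpect_gen_mul_gen_mul` p447372, `stub_asm_repr`) + Riemann sums of the free part in the frame
band e_K (`HubbardFreePropagatorLimit` pattern) + dominated convergence over k₀ (|Ĉ_K -/
@[route_item "route-HubbardSuperconductivity-KLProgramme"]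
def KLRegimeTwoPointAssemblyV7 : Prop :=
  Summit.HubbardSuperconductivity.HubbardSuperconductivity.Theorems.KLRegimeSplit.TwoPointAssemblyP3 Summit.HubbardSuperconductivity.HubbardSuperconductivity.Theorems.KLRegimeSplit.klPredsV7 Summit.HubbardSuperconductivity.HubbardSuperconductivity.Theorems.KLRegimeSplit.FinalTwoLegVolLimit Summit.HubbardSuperconductivity.HubbardSuperconductivity.Theorems.KLRegimeSplit.klWindowC

-- `KLRegimeTwoPointAssemblyV7` holds: proved by `Summit.HubbardSuperconductivity.HubbardSuperconductivity.Theorems.TwoPointAssembly.KLRegimeTwoPointAssemblyV7_of` (its module imports this route file, so no `_holds` link can be stated here).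

-- parent: KLRegimeTwoPointLimit · child (gen 2)
/--     item stmt-HubbardSuperconductivity-19667 · support · rank 206 · closed · proved by Summit.HubbardSuperconductivity.HubbardSuperconductivity.Theorems.klRegimeTwoPointLimitGlueV7_proof (prover)
    parent: KLRegimeTwoPointLimit · by operator
KLRegimeEngineV7 → KLRegimeBetaSplitV7 → KLRegimeCountertermV7 → KLRegimeVolumeLimitV7 →
KLRegimeTwoPointAssemblyV7 → KLRegimeTwoPointLimit (proved downstream:
Summit.HubbardSuperconductivity.HubbardSuperconductivity.Theorems.KLRegimeSplit.KLRegimeInductionV7P3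
= KLRegimeInductionP3 klPredsV7 FinalTwoLegVolLimit; 1-line closer to be landed in a Theorems module
--workitem <this glue item>) -/
@[route_item "route-HubbardSuperconductivity-KLProgramme"]
def KLRegimeTwoPointLimitGlueV7 : Prop :=
  KLRegimeEngineV7 → KLRegimeBetaSplitV7 → KLRegimeCountertermV7 → KLRegimeVolumeLimitV7 → KLRegimeTwoPointAssemblyV7 → KLRegimeTwoPointLimit

-- `KLRegimeTwoPointLimitGlueV7` holds: proved by `Summit.HubbardSuperconductivity.HubbardSuperconductivity.Theorems.klRegimeTwoPointLimitGlueV7_proof` (its module imports this route file, so no `_holds` link can be stated here).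

-- parent: KLRegimeTwoPointLimit · child (gen 3)
/--     item stmt-HubbardSuperconductivity-19824 · crux · rank 202 · closed · proved by Summit.HubbardSuperconductivity.HubbardSuperconductivity.Theorems.klRegimeBetaSplitV11_proof (prover)
    parent: KLRegimeTwoPointLimit · by planner
    why it might fail: A mis-identified O(U²)-per-scale piece in a D₄ block — transport between sector carriers (ENGINE-PRED §7(c)), one-sector DOS anisotropy, the Wick offset counted per step, the κ₀·Q.CR·Klam³ leg term — crosses the 2(a_Γ+C_Σ)U² Riccati envelope after O(1) ≪ n_β scales; κ₀ = 4000 may be too small.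
    sources: HOME/DECOMP.md App. E (E.1–E.5), HOME/prover-p1b/BETASPLIT-PRED.md, arXiv:cond-mat/0507686 §3 (3.65)–(3.70), arXiv:math-ph/0209046 §VI, FeldmanTrubowitz1991Flow Thm V.1, (1.55), Theorems/KLProgrammeCooperChannelRiccatiFlowBlock.lean blockFlow_envelopes
[crux] child 1 — the SIGN-RESOLVED BETA SPLIT as ONE strong-induction step (DECOMP Lemma E.4): ∀ G,
∃ P, ∀ Q, ∃ c₀ > 0 (where β ≤ e^{c/U²} is spent: no onset, (A₀+Ē)·B̄_n < 1), ∀ c ≤ c₀ ∀ R, ∃ U₀ L₁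
M₁: in the regime on klWindowC, for every admissible frame, L ≥ L₁ β U, M ≥ M₁ β U L and every n in
the generic range: `HistP
Summit.HubbardSuperconductivity.HubbardSuperconductivity.Theorems.KLRegimeSplit.klPredsV11` n +
`EngineBoundsAtV7S` at n + `TwoLegStepV11` at n ⟹ `BetaSplitAtS2` (pair-array tolerance `(P.C_W +
klLegKappa·Q.CR·P.Klam³)·U²`, Δ15: the leg-dressing constant is Q-staged, child 1 uses Q.CR and
never dominates it) at n := `PairArrayAtV2` ((B1) Cooper blocks of the localised quartic part inside
C2's Riccati envelopes — `attractiveEnvelope_step`/`repulsiveEnvelope_step` applied to the (E2)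
ladder step; Sherman–Morrison/Neumann resummation of the Cooper amplitude ARRAY in the weighted
max-entry norm, sign lever = U > 0 in the s-wave denominator — `…CooperResummationOffdiag`,
`…CooperResummationWeighted`, `…ChildOneClosersS`) ∧ `EndpointLineS` ((B2) endpoint VALUE line on
the spin-(0,1) line, (S)) ∧ `FirstMoments` ((B4)); (B3) non-Cooper tuples frozen = (E2′) summed
agains -/
@[route_item "route-HubbardSuperconductivity-KLProgramme"]
def KLRegimeBetaSplitV11 : Prop :=
  Summit.HubbardSuperconductivity.HubbardSuperconductivity.Theorems.KLRegimeSplit.BetaSplitP Summit.HubbardSuperconductivity.HubbardSuperconductivity.Theorems.KLRegimeSplit.klPredsV11 Summit.HubbardSuperconductivity.HubbardSuperconductivity.Theorems.KLRegimeSplit.klWindowC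

-- `KLRegimeBetaSplitV11` holds: proved by `Summit.HubbardSuperconductivity.HubbardSuperconductivity.Theorems.klRegimeBetaSplitV11_proof` (its module imports this route file, so no `_holds` link can be stated here).

-- parent: KLRegimeTwoPointLimit · child (gen 3)
/--     item stmt-HubbardSuperconductivity-19825 · crux · rank 203 · closed · proved by Summit.HubbardSuperconductivity.HubbardSuperconductivity.Theorems.KLRegimeCounterterm.KLRegimeCountertermV11_of (prover)
    parent: KLRegimeTwoPointLimit · by planner
    why it might fail: Wholesale continuation K = −Σ_{i≤n} ℓ_i(K): FrameOK (j ≤ 4) of EVERY Picard iterate must come from (E3a-MS) + tier 1 with Gfr_j = 2(S_j+1); (E3c) K-Lipschitz < 1 uniformly in volume (fails near the KL onset); mean split removes all O(U) angular constants (K-tadpoles); Σ_n CL β n/L₀ ≤ half tolerance.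
    sources: arXiv:math-ph/0001031 (FST IV inversion, CPAM 53 (2000) 1350), arXiv:cond-mat/0507686 §2 (2.23), (2.36), Mastropietro2005 Lemma 2 (Literature …FermiRG.Mastropietro2005: lemma2Statement_of_lipschitz), Salmhofer1998 (4.296), HOME/DECOMP.md App. C, App. D, HOME/prover-p4/INVERSION-NOTE.md
[crux] child 2 — the VOLUME-UNIFORM COUNTERTERM FIXED POINT (FST's inversion by successive
approximation in the counterterm scheme; Δ8 staging ∀ G ∀ P ∃ R ∀ Q ∃ c₁ > 0 ∀ c ≤ c₁ ∃ U₀ — R is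
chosen knowing only (G, P), so the engine's Q may depend on R): in the regime at (ν,U,β), ν ∈
klWindowC, and for ANY volume thresholds (Lh, Mh): IF for every admissible frame K and every L ≥ Lh,
M ≥ Mh L renormalisation of K below n (`RenormalisedAtF`: Fermi-curve mismatch ≤ cr|U|Λ_n²/e₀,
quadratic tolerance, no wave-function clause) yields the engine output `EngineBoundsAtV7S` (Δ15:
leg-dressing majorant `legDressBarQ G P Q U n c = Q.CR·((P.Klam·U)²·4^{−n} + (P.Klam·|U|)³)·c`, Q
chosen after R), the two-leg step `TwoLegStepV11` (incl. the (E3f) two-volume rate) and the split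
`BetaSplitAtS2` at n (all n in the generic range — exactly what the glue's induction makes of
children 3 + 1), THEN there is ONE admissible frame K chosen BEFORE the volume (Δ1) and thresholds
(Lc, Mc) such that K is renormalised down to EVERY scale at every L ≥ Lc, M ≥ Mc L: the counterterm
map K ↦ −Σ_n ℓ_n(K) (ℓ_n = `klLocalPart` of the scale-n two-leg output; with the Δ13 repair its
constant angular mean is the δμ flow an -/
@[route_item "route-HubbardSuperconductivity-KLProgramme"]
def KLRegimeCountertermV11 : Prop :=
  Summit.HubbardSuperconductivity.HubbardSuperconductivity.Theorems.KLRegimeSplit.CountertermP2 Summit.HubbardSuperconductivity.HubbardSuperconductivity.Theorems.KLRegimeSplit.klPredsV11 Summit.HubbardSuperconductivity.HubbardSuperconductivity.Theorems.KLRegimeSplit.klWindowC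

-- `KLRegimeCountertermV11` holds: proved by `Summit.HubbardSuperconductivity.HubbardSuperconductivity.Theorems.KLRegimeCounterterm.KLRegimeCountertermV11_of` (its module imports this route file, so no `_holds` link can be stated here).

-- parent: KLRegimeTwoPointLimit · child (gen 3)
/--     item stmt-HubbardSuperconductivity-19827 · crux · rank 205 · closed · proved by Summit.HubbardSuperconductivity.HubbardSuperconductivity.Theorems.TwoPointAssembly.KLRegimeTwoPointAssemblyV11_of (prover)
    parent: KLRegimeTwoPointLimit · by planner
    why it might fail: The (C,V) ↔ (C_K,V_K) covariance change is in the tree only at the Berezin level, not for gaussConv/effAction; the source shift needs exactly index nScales β + 1; t2's all-U Matsubara bound must be L-uniform enough for FinalTwoLegVolLimit's ε–L₁–M₁ order; free-part mismatch ν vs ν + U/2 leaves O(U).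
    sources: arXiv:cond-mat/0507686 §2.4, Lemmas 2.4–2.5, Literature/MathematicalPhysics/QuantumLattice/FermiRG/BGM2006Sec2TwoPoint.lean (Lemma24, Lemma25), Literature/MathematicalPhysics/QuantumLattice/HubbardTwoPointMatsubaraLimit.lean, HOME/t2/MATSUBARA-ALLU-SCOPE.md, Theorems/KLProgrammeKLRegimeTwoPointAssemblyGrassmannRepr.lean (p447372, gaussExpect_gen_mul_gen_mul), HOME/hubbard-kl-r2d-p2/SKELETON-asm-repr.lean (stub_asm_matsubara/partition/frame/repr/volume)
[crux] child 4 — TWO-POINT ASSEMBLY in one frame (BGM 2006 §2.4 / Lemma 2.5's role; Δ-asm-repaired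
`TwoPointAssemblyP3`, hypothesis block `TowerP`): ∀ G P Q R ∀ c > 0 ∃ U₀: in the regime at (ν,U,β),
IF ONE admissible frame K (fixed before the volume) is renormalised, split, engine-bounded and
two-leg-controlled at every scale n ≤ nScales β + 1 (R1: the last slice is fully integrated) for all
L ≥ L⋆, M ≥ M⋆ L AND `FinalTwoLegVolLimit β U ν K M⋆` holds for THE SAME K (child 5's output, inside
the ∃K hypothesis), THEN the finite-volume equal-time thermal two-point functions
`hubbardThermalTwoPoint β U (ν + U/2) L x y σ σ'` (physical μ = ν + U/2, Hartree shift Δ5) converge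
as L → ∞: Matsubara UV M → ∞ for every real U (t2:
`tendsto_grassmannTwoPoint_eq_hubbardThermalTwoPoint_sub_allU` line, `stub_asm_matsubara`) +
Gaussian change of covariance (C,V) ↔ (C_K,V_K) (`GrassmannGaussianMeasureChange`, `stub_asm_frame`)
+ source-shift representation G = C_K − C_K·𝒱₂·C_K (`GrassmannGaussianSourceShift`, landed
`gaussExpect_gen_mul_gen_mul` p447372, `stub_asm_repr`) + Riemann sums of the free part in the frame
band e_K (`HubbardFreePropagatorLimit` pattern) + dominated convergence over k₀ (|Ĉ_K -/
@[route_item "route-HubbardSuperconductivity-KLProgramme"]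
def KLRegimeTwoPointAssemblyV11 : Prop :=
  Summit.HubbardSuperconductivity.HubbardSuperconductivity.Theorems.KLRegimeSplit.TwoPointAssemblyP3 Summit.HubbardSuperconductivity.HubbardSuperconductivity.Theorems.KLRegimeSplit.klPredsV11 Summit.HubbardSuperconductivity.HubbardSuperconductivity.Theorems.KLRegimeSplit.FinalTwoLegVolLimit Summit.HubbardSuperconductivity.HubbardSuperconductivity.Theorems.KLRegimeSplit.klWindowC

-- `KLRegimeTwoPointAssemblyV11` holds: proved by `Summit.HubbardSuperconductivity.HubbardSuperconductivity.Theorems.TwoPointAssembly.KLRegimeTwoPointAssemblyV11_of` (its module imports this route file, so no `_holds` link can be stated here).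

-- parent: KLRegimeTwoPointLimit · child (gen 3)
/--     item stmt-HubbardSuperconductivity-19828 · support · rank 206 · closed · proved by Summit.HubbardSuperconductivity.HubbardSuperconductivity.Theorems.klRegimeTwoPointLimitGlueV11_proof (prover)
    parent: KLRegimeTwoPointLimit · by planner
KLRegimeEngineV11 → KLRegimeBetaSplitV11 → KLRegimeCountertermV11 → KLRegimeVolumeLimitV11 →
KLRegimeTwoPointAssemblyV11 → KLRegimeTwoPointLimit (proved downstream:
Summit.HubbardSuperconductivity.HubbardSuperconductivity.Theorems.KLRegimeSplit.KLRegimeInductionV11P4;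
1-line closer to be landed in a Theorems module --workitem <this glue item>) -/
@[route_item "route-HubbardSuperconductivity-KLProgramme"]
def KLRegimeTwoPointLimitGlueV11 : Prop :=
  KLRegimeEngineV11 → KLRegimeBetaSplitV11 → KLRegimeCountertermV11 → KLRegimeVolumeLimitV11 → KLRegimeTwoPointAssemblyV11 → KLRegimeTwoPointLimit

-- `KLRegimeTwoPointLimitGlueV11` holds: proved by `Summit.HubbardSuperconductivity.HubbardSuperconductivity.Theorems.klRegimeTwoPointLimitGlueV11_proof` (its module imports this route file, so no `_holds` link can be stated here).

-- parent: KLRegimeTwoPointLimit · child (gen 4)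
/--     item stmt-HubbardSuperconductivity-19856 · crux · rank 202 · closed · proved by Summit.HubbardSuperconductivity.HubbardSuperconductivity.Theorems.klRegimeBetaSplitV12_proof (prover)
    parent: KLRegimeTwoPointLimit · by planner
    why it might fail: A mis-identified O(U²)-per-scale piece in a D₄ block — transport between sector carriers (ENGINE-PRED §7(c)), one-sector DOS anisotropy, the Wick offset counted per step, the κ₀·Q.CR·Klam³ leg term — crosses the 2(a_Γ+C_Σ)U² Riccati envelope after O(1) ≪ n_β scales; κ₀ = 4000 may be too small.
    sources: HOME/DECOMP.md App. E (E.1–E.5), HOME/prover-p1b/BETASPLIT-PRED.md, arXiv:cond-mat/0507686 §3 (3.65)–(3.70), arXiv:math-ph/0209046 §VI, FeldmanTrubowitz1991Flow Thm V.1, (1.55), Theorems/KLProgrammeCooperChannelRiccatiFlowBlock.lean blockFlow_envelopes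
[crux] child 1 — the SIGN-RESOLVED BETA SPLIT as ONE strong-induction step (DECOMP Lemma E.4): ∀ G,
∃ P, ∀ Q, ∃ c₀ > 0 (where β ≤ e^{c/U²} is spent: no onset, (A₀+Ē)·B̄_n < 1), ∀ c ≤ c₀ ∀ R, ∃ U₀ L₁
M₁: in the regime on klWindowC, for every admissible frame, L ≥ L₁ β U, M ≥ M₁ β U L and every n in
the generic range: `HistP
Summit.HubbardSuperconductivity.HubbardSuperconductivity.Theorems.KLRegimeSplit.klPredsV12` n +
`EngineBoundsAtV8S` at n + `TwoLegStepV12` at n ⟹ `BetaSplitAtS2` (pair-array tolerance `(P.C_W +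
klLegKappa·Q.CR·P.Klam³)·U²`, Δ15: the leg-dressing constant is Q-staged, child 1 uses Q.CR and
never dominates it) at n := `PairArrayAtV2` ((B1) Cooper blocks of the localised quartic part inside
C2's Riccati envelopes — `attractiveEnvelope_step`/`repulsiveEnvelope_step` applied to the (E2)
ladder step; Sherman–Morrison/Neumann resummation of the Cooper amplitude ARRAY in the weighted
max-entry norm, sign lever = U > 0 in the s-wave denominator — `…CooperResummationOffdiag`,
`…CooperResummationWeighted`, `…ChildOneClosersS`) ∧ `EndpointLineS` ((B2) endpoint VALUE line on
the spin-(0,1) line, (S)) ∧ `FirstMoments` ((B4)); (B3) non-Cooper tuples frozen = (E2′) summed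
agains -/
@[route_item "route-HubbardSuperconductivity-KLProgramme"]
def KLRegimeBetaSplitV12 : Prop :=
  Summit.HubbardSuperconductivity.HubbardSuperconductivity.Theorems.KLRegimeSplit.BetaSplitP Summit.HubbardSuperconductivity.HubbardSuperconductivity.Theorems.KLRegimeSplit.klPredsV12 Summit.HubbardSuperconductivity.HubbardSuperconductivity.Theorems.KLRegimeSplit.klWindowC

-- `KLRegimeBetaSplitV12` holds: proved by `Summit.HubbardSuperconductivity.HubbardSuperconductivity.Theorems.klRegimeBetaSplitV12_proof` (its module imports this route file, so no `_holds` link can be stated here).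

-- parent: KLRegimeTwoPointLimit · child (gen 4)
/--     item stmt-HubbardSuperconductivity-19857 · crux · rank 203 · closed · proved by Summit.HubbardSuperconductivity.HubbardSuperconductivity.Theorems.KLRegimeCounterterm.KLRegimeCountertermV12_of (prover)
    parent: KLRegimeTwoPointLimit · by planner
    why it might fail: Wholesale continuation K = −Σ_{i≤n} ℓ_i(K): FrameOK (j ≤ 4) of EVERY Picard iterate must come from (E3a-MS) + tier 1 with Gfr_j = 2(S_j+1); (E3c) K-Lipschitz < 1 uniformly in volume (fails near the KL onset); mean split removes all O(U) angular constants (K-tadpoles); Σ_n CL β n/L₀ ≤ half tolerance.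
    sources: arXiv:math-ph/0001031 (FST IV inversion, CPAM 53 (2000) 1350), arXiv:cond-mat/0507686 §2 (2.23), (2.36), Mastropietro2005 Lemma 2 (Literature …FermiRG.Mastropietro2005: lemma2Statement_of_lipschitz), Salmhofer1998 (4.296), HOME/DECOMP.md App. C, App. D, HOME/prover-p4/INVERSION-NOTE.md
[crux] child 2 — the VOLUME-UNIFORM COUNTERTERM FIXED POINT (FST's inversion by successive
approximation in the counterterm scheme; Δ8 staging ∀ G ∀ P ∃ R ∀ Q ∃ c₁ > 0 ∀ c ≤ c₁ ∃ U₀ — R is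
chosen knowing only (G, P), so the engine's Q may depend on R): in the regime at (ν,U,β), ν ∈
klWindowC, and for ANY volume thresholds (Lh, Mh): IF for every admissible frame K and every L ≥ Lh,
M ≥ Mh L renormalisation of K below n (`RenormalisedAtF`: Fermi-curve mismatch ≤ cr|U|Λ_n²/e₀,
quadratic tolerance, no wave-function clause) yields the engine output `EngineBoundsAtV8S` (Δ15:
leg-dressing majorant `legDressBarQ G P Q U n c = Q.CR·((P.Klam·U)²·4^{−n} + (P.Klam·|U|)³)·c`, Q
chosen after R), the two-leg step `TwoLegStepV12` (incl. the (E3f) two-volume rate) and the split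
`BetaSplitAtS2` at n (all n in the generic range — exactly what the glue's induction makes of
children 3 + 1), THEN there is ONE admissible frame K chosen BEFORE the volume (Δ1) and thresholds
(Lc, Mc) such that K is renormalised down to EVERY scale at every L ≥ Lc, M ≥ Mc L: the counterterm
map K ↦ −Σ_n ℓ_n(K) (ℓ_n = `klLocalPart` of the scale-n two-leg output; with the Δ13 repair its
constant angular mean is the δμ flow an -/
@[route_item "route-HubbardSuperconductivity-KLProgramme"]
def KLRegimeCountertermV12 : Prop :=
  Summit.HubbardSuperconductivity.HubbardSuperconductivity.Theorems.KLRegimeSplit.CountertermP2 Summit.HubbardSuperconductivity.HubbardSuperconductivity.Theorems.KLRegimeSplit.klPredsV12 Summit.HubbardSuperconductivity.HubbardSuperconductivity.Theorems.KLRegimeSplit.klWindowC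

-- `KLRegimeCountertermV12` holds: proved by `Summit.HubbardSuperconductivity.HubbardSuperconductivity.Theorems.KLRegimeCounterterm.KLRegimeCountertermV12_of` (its module imports this route file, so no `_holds` link can be stated here).

-- parent: KLRegimeTwoPointLimit · child (gen 4)
/--     item stmt-HubbardSuperconductivity-19859 · crux · rank 205 · closed · proved by Summit.HubbardSuperconductivity.HubbardSuperconductivity.Theorems.TwoPointAssembly.KLRegimeTwoPointAssemblyV12_of (prover)
    parent: KLRegimeTwoPointLimit · by planner
    why it might fail: None in the statement: with the ∃-threshold slot it IS `twoPointAssemblyP3_ex klPredsV12 klWindowC` (G6a p475968 via p470883) and closes at birth; the content risk (L-uniform all-U Matsubara bound, covariance change at effAction level, index nScales β+1) moved to child 5 + the engine export.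
    sources: Theorems/KLProgrammeKLRegimeVolumeLimitExDefs.lean (G6a p475968: twoPointAssemblyP3_klPredsV12_ex), Theorems/KLProgrammeKLRegimeTwoPointAssemblySlotThreshold.lean (p470883), arXiv:cond-mat/0507686 §2.4, Lemmas 2.4–2.5, Literature/MathematicalPhysics/QuantumLattice/FermiRG/BGM2006Sec2TwoPoint.lean (Lemma24, Lemma25), Literature/MathematicalPhysics/QuantumLattice/HubbardTwoPointMatsubaraLimit.lean, HOME/t2/MATSUBARA-ALLU-SCOPE.md
[crux] child 4 — TWO-POINT ASSEMBLY in one frame (BGM 2006 §2.4 / Lemma 2.5's role; Δ-asm-repaired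
`TwoPointAssemblyP3`, hypothesis block `TowerP`): ∀ G P Q R ∀ c > 0 ∃ U₀: in the regime at (ν,U,β),
IF ONE admissible frame K (fixed before the volume) is renormalised, split, engine-bounded and
two-leg-controlled at every scale n ≤ nScales β + 1 (R1: the last slice is fully integrated) for all
L ≥ L⋆, M ≥ M⋆ L AND `FinalTwoLegVolLimitEx β U ν K M⋆` (the ∃-threshold slot, Δ-VL1 g11 l.1361, G6a
p475968) holds for THE SAME K (child 5's output, inside the ∃K hypothesis), THEN the finite-volume
equal-time thermal two-point functions `hubbardThermalTwoPoint β U (ν + U/2) L x y σ σ'` (physical μ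
= ν + U/2, Hartree shift Δ5) converge as L → ∞: Matsubara UV M → ∞ for every real U (t2:
`tendsto_grassmannTwoPoint_eq_hubbardThermalTwoPoint_sub_allU` line, `stub_asm_matsubara`) +
Gaussian change of covariance (C,V) ↔ (C_K,V_K) (`GrassmannGaussianMeasureChange`, `stub_asm_frame`)
+ source-shift representation G = C_K − C_K·𝒱₂·C_K (`GrassmannGaussianSourceShift`, landed
`gaussExpect_gen_mul_gen_mul` p447372, `stub_asm_repr`) + Riemann sums of the free part in the frame
band e_K (`HubbardFreePropaga -/
@[route_item "route-HubbardSuperconductivity-KLProgramme"]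
def KLRegimeTwoPointAssemblyV12 : Prop :=
  Summit.HubbardSuperconductivity.HubbardSuperconductivity.Theorems.KLRegimeSplit.TwoPointAssemblyP3 Summit.HubbardSuperconductivity.HubbardSuperconductivity.Theorems.KLRegimeSplit.klPredsV12 Summit.HubbardSuperconductivity.HubbardSuperconductivity.Theorems.KLRegimeSplit.FinalTwoLegVolLimitEx Summit.HubbardSuperconductivity.HubbardSuperconductivity.Theorems.KLRegimeSplit.klWindowC

-- `KLRegimeTwoPointAssemblyV12` holds: proved by `Summit.HubbardSuperconductivity.HubbardSuperconductivity.Theorems.TwoPointAssembly.KLRegimeTwoPointAssemblyV12_of` (its module imports this route file, so no `_holds` link can be stated here).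

-- parent: KLRegimeTwoPointLimit · child (gen 4)
/--     item stmt-HubbardSuperconductivity-19860 · support · rank 206 · closed · proved by Summit.HubbardSuperconductivity.HubbardSuperconductivity.Theorems.KLRegimeSplit.klRegimeTwoPointLimitGlueV12_holds (prover)
    parent: KLRegimeTwoPointLimit · by planner
KLRegimeEngineV12 → KLRegimeBetaSplitV12 → KLRegimeCountertermV12 → KLRegimeVolumeLimitV12 →
KLRegimeTwoPointAssemblyV12 → KLRegimeTwoPointLimit (proved downstream:
Summit.HubbardSuperconductivity.HubbardSuperconductivity.Theorems.KLRegimeSplit.KLRegimeInductionV12P4Ex;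
1-line closer to be landed in a Theorems module --workitem <this glue item>) -/
@[route_item "route-HubbardSuperconductivity-KLProgramme"]
def KLRegimeTwoPointLimitGlueV12 : Prop :=
  KLRegimeEngineV12 → KLRegimeBetaSplitV12 → KLRegimeCountertermV12 → KLRegimeVolumeLimitV12 → KLRegimeTwoPointAssemblyV12 → KLRegimeTwoPointLimit

-- `KLRegimeTwoPointLimitGlueV12` holds: proved by `Summit.HubbardSuperconductivity.HubbardSuperconductivity.Theorems.KLRegimeSplit.klRegimeTwoPointLimitGlueV12_holds` (its module imports this route file, so no `_holds` link can be stated here).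

-- parent: KLRegimeTwoPointLimit · child (gen 5)
/--     item stmt-HubbardSuperconductivity-19919 · crux · rank 202 · closed · proved by Summit.HubbardSuperconductivity.HubbardSuperconductivity.Theorems.klRegimeBetaSplitV14_proof (prover)
    parent: KLRegimeTwoPointLimit · by planner
    why it might fail: None in the statement once `betaSplitP_of_slotsV9S` is ACCEPTED (closes at birth): the (X) source is entrywise non-negative with per-step sup and pointwise scale sum ≤ 2CF(Klam U)², exactly the generic edge-clause shape; residual risk = the numerals (3, 8, 10/3, 48, 15) vs the leg line 720 ≤ 4000.
    sources: HOME/DECOMP.md App. E (E.1–E.5); HOME/prover-p1b/BETASPLIT-PRED.md, arXiv:cond-mat/0507686 §3 (3.65)–(3.70), arXiv:math-ph/0209046 §VI, FeldmanTrubowitz1991Flow Thm V.1, (1.55), Theorems/KLProgrammeCooperChannelRiccatiFlowBlock.lean blockFlow_envelopes, Theorems/KLProgrammeKLRegimeTwoPointLimitTwoShellBound.lean kltb_exists_twoShell_bound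
[crux] child 1 — the SIGN-RESOLVED BETA SPLIT as ONE strong-induction step (DECOMP Lemma E.4): ∀ G,
∃ P, ∀ Q, ∃ c₀ > 0 (where β ≤ e^{c/U²} is spent: no onset, (A₀+Ē)·B̄_n < 1), ∀ c ≤ c₀ ∀ R, ∃ U₀ L₁
M₁: in the regime on klWindowC, for every admissible frame, L ≥ L₁ β U, M ≥ M₁ β U L and every n in
the generic range: `HistP
Summit.HubbardSuperconductivity.HubbardSuperconductivity.Theorems.KLRegimeSplit.klPredsV14` n +
`EngineBoundsAtV9S` at n + `TwoLegStepV14` at n ⟹ `BetaSplitAtS2` (pair-array tolerance `(P.C_W +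
klLegKappa·Q.CR·P.Klam³)·U²`, Δ15: the leg-dressing constant is Q-staged, child 1 uses Q.CR and
never dominates it) at n := `PairArrayAtV2` ((B1) Cooper blocks of the localised quartic part inside
C2's Riccati envelopes — `attractiveEnvelope_step`/`repulsiveEnvelope_step` applied to the (E2)
ladder step; Sherman–Morrison/Neumann resummation of the Cooper amplitude ARRAY in the weighted
max-entry norm, sign lever = U > 0 in the s-wave denominator — `…CooperResummationOffdiag`,
`…CooperResummationWeighted`, `…ChildOneClosersS`) ∧ `EndpointLineS` ((B2) endpoint VALUE line on
the spin-(0,1) line, (S)) ∧ `FirstMoments` ((B4)); (B3) non-Cooper tuples frozen = (E2′) summed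
agains -/
@[route_item "route-HubbardSuperconductivity-KLProgramme"]
def KLRegimeBetaSplitV14 : Prop :=
  Summit.HubbardSuperconductivity.HubbardSuperconductivity.Theorems.KLRegimeSplit.BetaSplitP Summit.HubbardSuperconductivity.HubbardSuperconductivity.Theorems.KLRegimeSplit.klPredsV14 Summit.HubbardSuperconductivity.HubbardSuperconductivity.Theorems.KLRegimeSplit.klWindowC

-- `KLRegimeBetaSplitV14` holds: proved by `Summit.HubbardSuperconductivity.HubbardSuperconductivity.Theorems.klRegimeBetaSplitV14_proof` (its module imports this route file, so no `_holds` link can be stated here).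

-- parent: KLRegimeTwoPointLimit · child (gen 5)
/--     item stmt-HubbardSuperconductivity-19920 · crux · rank 203 · closed · proved by Summit.HubbardSuperconductivity.HubbardSuperconductivity.Theorems.KLRegimeCounterterm.KLRegimeCountertermV14_of (prover)
    parent: KLRegimeTwoPointLimit · by planner
    why it might fail: Wholesale continuation K = −𝒥_dΣ_{i≤n}ℓ_i(K): FrameOK (j ≤ 4) of every Picard iterate from (E3a-MS) + tier 1 with Gfr_j = 2(S_j+1), Jackson constant 1; (E3c) K-Lipschitz < 1 uniformly in volume (fails near the KL onset); smoothing error c₂‖D²F‖/(d+1)² + Σ_n CL β n/L₀ within tolerance, d before L.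
    sources: arXiv:math-ph/0001031 (FST IV inversion, CPAM 53 (2000) 1350), arXiv:cond-mat/0507686 §2 (2.23), (2.36), Mastropietro2005 Lemma 2 (Literature …FermiRG.Mastropietro2005: lemma2Statement_of_lipschitz), Salmhofer1998 (4.296), HOME/DECOMP.md App. C, App. D; HOME/prover-p4/INVERSION-NOTE.md; HOME/prover-p1b/U5-NOTE.md, STATUS l.739/741/749 (Δ13), Theorems/KLProgrammeDispersionFlowDefs.lean FrameGeometry
[crux] child 2 — the VOLUME-UNIFORM COUNTERTERM FIXED POINT (FST's inversion by successive
approximation in the counterterm scheme; Δ8 staging ∀ G ∀ P ∃ R ∀ Q ∃ c₁ > 0 ∀ c ≤ c₁ ∃ U₀ — R is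
chosen knowing only (G, P), so the engine's Q may depend on R): in the regime at (ν,U,β), ν ∈
klWindowC, and for ANY volume thresholds (Lh, Mh): IF for every admissible frame K and every L ≥ Lh,
M ≥ Mh L renormalisation of K below n (`RenormalisedAtF`: Fermi-curve mismatch ≤ cr|U|Λ_n²/e₀,
quadratic tolerance, no wave-function clause) yields the engine output `EngineBoundsAtV9S` (Δ15:
leg-dressing majorant `legDressBarQ G P Q U n c = Q.CR·((P.Klam·U)²·4^{−n} + (P.Klam·|U|)³)·c`, Q
chosen after R), the two-leg step `TwoLegStepV14` (incl. the (E3f) two-volume rate) and the split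
`BetaSplitAtS2` at n (all n in the generic range — exactly what the glue's induction makes of
children 3 + 1), THEN there is ONE admissible frame K chosen BEFORE the volume (Δ1) and thresholds
(Lc, Mc) such that K is renormalised down to EVERY scale at every L ≥ Lc, M ≥ Mc L: the counterterm
map K ↦ −Σ_n ℓ_n(K) (ℓ_n = `klLocalPart` of the scale-n two-leg output; with the Δ13 repair its
constant angular mean is the δμ flow an -/
@[route_item "route-HubbardSuperconductivity-KLProgramme"]
def KLRegimeCountertermV14 : Prop :=
  Summit.HubbardSuperconductivity.HubbardSuperconductivity.Theorems.KLRegimeSplit.CountertermP2 Summit.HubbardSuperconductivity.HubbardSuperconductivity.Theorems.KLRegimeSplit.klPredsV14 Summit.HubbardSuperconductivity.HubbardSuperconductivity.Theorems.KLRegimeSplit.klWindowC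

-- `KLRegimeCountertermV14` holds: proved by `Summit.HubbardSuperconductivity.HubbardSuperconductivity.Theorems.KLRegimeCounterterm.KLRegimeCountertermV14_of` (its module imports this route file, so no `_holds` link can be stated here).

-- parent: KLRegimeTwoPointLimit · child (gen 5)
/--     item stmt-HubbardSuperconductivity-19922 · crux · rank 205 · closed · proved by Summit.HubbardSuperconductivity.HubbardSuperconductivity.Theorems.TwoPointAssembly.KLRegimeTwoPointAssemblyV14_of (prover)
    parent: KLRegimeTwoPointLimit · by planner
    why it might fail: None in the statement: with the ∃-threshold slot it IS `twoPointAssemblyP3_ex klPredsV14 klWindowC` (G6a p475968 via p470883) and closes at birth; the content risk (L-uniform all-U Matsubara bound, covariance change at effAction level, index nScales β+1) moved to child 5 + the engine export.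
    sources: Theorems/KLProgrammeKLRegimeVolumeLimitExDefs.lean (G6a p475968: twoPointAssemblyP3_klPredsV12_ex), Theorems/KLProgrammeKLRegimeTwoPointAssemblySlotThreshold.lean (p470883), arXiv:cond-mat/0507686 §2.4, Lemmas 2.4–2.5, Literature/MathematicalPhysics/QuantumLattice/FermiRG/BGM2006Sec2TwoPoint.lean (Lemma24, Lemma25), Literature/MathematicalPhysics/QuantumLattice/HubbardTwoPointMatsubaraLimit.lean, HOME/t2/MATSUBARA-ALLU-SCOPE.md; HOME/hubbard-kl-r2d-p2/SKELETON-asm-repr.lean (stub_asm_matsubara/partition/frame/repr/volume); HOME/planner-g9/SPLIT-ARCH.md R6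
[crux] child 4 — TWO-POINT ASSEMBLY in one frame (BGM 2006 §2.4 / Lemma 2.5's role; Δ-asm-repaired
`TwoPointAssemblyP3`, hypothesis block `TowerP`): ∀ G P Q R ∀ c > 0 ∃ U₀: in the regime at (ν,U,β),
IF ONE admissible frame K (fixed before the volume) is renormalised, split, engine-bounded and
two-leg-controlled at every scale n ≤ nScales β + 1 (R1: the last slice is fully integrated) for all
L ≥ L⋆, M ≥ M⋆ L AND `FinalTwoLegVolLimitEx β U ν K M⋆` (the ∃-threshold slot, Δ-VL1 g11 l.1361, G6a
p475968) holds for THE SAME K (child 5's output, inside the ∃K hypothesis), THEN the finite-volume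
equal-time thermal two-point functions `hubbardThermalTwoPoint β U (ν + U/2) L x y σ σ'` (physical μ
= ν + U/2, Hartree shift Δ5) converge as L → ∞: Matsubara UV M → ∞ for every real U (t2:
`tendsto_grassmannTwoPoint_eq_hubbardThermalTwoPoint_sub_allU` line, `stub_asm_matsubara`) +
Gaussian change of covariance (C,V) ↔ (C_K,V_K) (`GrassmannGaussianMeasureChange`, `stub_asm_frame`)
+ source-shift representation G = C_K − C_K·𝒱₂·C_K (`GrassmannGaussianSourceShift`, landed
`gaussExpect_gen_mul_gen_mul` p447372, `stub_asm_repr`) + Riemann sums of the free part in the frame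
band e_K (`HubbardFreePropaga -/
@[route_item "route-HubbardSuperconductivity-KLProgramme"]
def KLRegimeTwoPointAssemblyV14 : Prop :=
  Summit.HubbardSuperconductivity.HubbardSuperconductivity.Theorems.KLRegimeSplit.TwoPointAssemblyP3 Summit.HubbardSuperconductivity.HubbardSuperconductivity.Theorems.KLRegimeSplit.klPredsV14 Summit.HubbardSuperconductivity.HubbardSuperconductivity.Theorems.KLRegimeSplit.FinalTwoLegVolLimitEx Summit.HubbardSuperconductivity.HubbardSuperconductivity.Theorems.KLRegimeSplit.klWindowC

-- `KLRegimeTwoPointAssemblyV14` holds: proved by `Summit.HubbardSuperconductivity.HubbardSuperconductivity.Theorems.TwoPointAssembly.KLRegimeTwoPointAssemblyV14_of` (its module imports this route file, so no `_holds` link can be stated here).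

-- parent: KLRegimeTwoPointLimit · child (gen 5)
/--     item stmt-HubbardSuperconductivity-19923 · support · rank 206 · closed · proved by Summit.HubbardSuperconductivity.HubbardSuperconductivity.Theorems.KLRegimeSplit.klRegimeTwoPointLimitGlueV14_holds (prover)
    parent: KLRegimeTwoPointLimit · by planner
KLRegimeEngineV14 → KLRegimeBetaSplitV14 → KLRegimeCountertermV14 → KLRegimeVolumeLimitV14 →
KLRegimeTwoPointAssemblyV14 → KLRegimeTwoPointLimit (proved downstream:
Summit.HubbardSuperconductivity.HubbardSuperconductivity.Theorems.KLRegimeSplit.KLRegimeInductionV14P4Ex;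
1-line closer to be landed in a Theorems module --workitem <this glue item>) -/
@[route_item "route-HubbardSuperconductivity-KLProgramme"]
def KLRegimeTwoPointLimitGlueV14 : Prop :=
  KLRegimeEngineV14 → KLRegimeBetaSplitV14 → KLRegimeCountertermV14 → KLRegimeVolumeLimitV14 → KLRegimeTwoPointAssemblyV14 → KLRegimeTwoPointLimit

-- `KLRegimeTwoPointLimitGlueV14` holds: proved by `Summit.HubbardSuperconductivity.HubbardSuperconductivity.Theorems.KLRegimeSplit.klRegimeTwoPointLimitGlueV14_holds` (its module imports this route file, so no `_holds` link can be stated here).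

-- parent: KLRegimeTwoPointLimit · child (gen 6)
/--     item stmt-HubbardSuperconductivity-20237 · crux · rank 202 · closed · proved by Summit.HubbardSuperconductivity.HubbardSuperconductivity.Theorems.klRegimeBetaSplitV16_proof (prover)
    parent: KLRegimeTwoPointLimit · by planner
    why it might fail: None in the statement once `betaSplitP_of_slotsV10S` is ACCEPTED (closes at birth): (X) source entrywise non-negative with per-step sup and scale sum ≤ 2CF(Klam U)²; `legDressBarQ2` read through the same two inequalities; residual = numerals (3, 8, 10/3, 48, 15) vs the leg line 720 ≤ 4000.
    sources: HOME/DECOMP.md App. E (E.1–E.5); HOME/prover-p1b/BETASPLIT-PRED.md, arXiv:cond-mat/0507686 §3 (3.65)–(3.70), arXiv:math-ph/0209046 §VI, FeldmanTrubowitz1991Flow Thm V.1, (1.55), Theorems/KLProgrammeCooperChannelRiccatiFlowBlock.lean blockFlow_envelopes, Theorems/KLProgrammeKLRegimeTwoPointLimitTwoShellBound.lean kltb_exists_twoShell_bound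
[crux] child 1 — the SIGN-RESOLVED BETA SPLIT as ONE strong-induction step (DECOMP Lemma E.4): ∀ G,
∃ P, ∀ Q, ∃ c₀ > 0 (where β ≤ e^{c/U²} is spent: no onset, (A₀+Ē)·B̄_n < 1), ∀ c ≤ c₀ ∀ R, ∃ U₀ L₁
M₁: in the regime on klWindowC, for every admissible frame, L ≥ L₁ β U, M ≥ M₁ β U L and every n in
the generic range: `HistP
Summit.HubbardSuperconductivity.HubbardSuperconductivity.Theorems.KLRegimeSplit.klPredsV16` n +
`EngineBoundsAtV10S` at n + `TwoLegStepV16` at n ⟹ `BetaSplitAtS2` (pair-array tolerance `(P.C_W +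
klLegKappa·Q.CR·P.Klam³)·U²`, Δ15: the leg-dressing constant is Q-staged, child 1 uses Q.CR and
never dominates it) at n := `PairArrayAtV2` ((B1) Cooper blocks of the localised quartic part inside
C2's Riccati envelopes — `attractiveEnvelope_step`/`repulsiveEnvelope_step` applied to the (E2)
ladder step; Sherman–Morrison/Neumann resummation of the Cooper amplitude ARRAY in the weighted
max-entry norm, sign lever = U > 0 in the s-wave denominator — `…CooperResummationOffdiag`,
`…CooperResummationWeighted`, `…ChildOneClosersS`) ∧ `EndpointLineS` ((B2) endpoint VALUE line on
the spin-(0,1) line, (S)) ∧ `FirstMoments` ((B4)); (B3) non-Cooper tuples frozen = (E2′) summed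
again -/
@[route_item "route-HubbardSuperconductivity-KLProgramme"]
def KLRegimeBetaSplitV16 : Prop :=
  Summit.HubbardSuperconductivity.HubbardSuperconductivity.Theorems.KLRegimeSplit.BetaSplitP Summit.HubbardSuperconductivity.HubbardSuperconductivity.Theorems.KLRegimeSplit.klPredsV16 Summit.HubbardSuperconductivity.HubbardSuperconductivity.Theorems.KLRegimeSplit.klWindowC

-- `KLRegimeBetaSplitV16` holds: proved by `Summit.HubbardSuperconductivity.HubbardSuperconductivity.Theorems.klRegimeBetaSplitV16_proof` (its module imports this route file, so no `_holds` link can be stated here).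

-- parent: KLRegimeTwoPointLimit · child (gen 6)
/--     item stmt-HubbardSuperconductivity-20238 · crux · rank 203 · closed · proved by Summit.HubbardSuperconductivity.HubbardSuperconductivity.Theorems.KLRegimeCounterterm.KLRegimeCountertermV16_of (prover)
    parent: KLRegimeTwoPointLimit · by planner
    why it might fail: None in the statement once `CtJ.countertermP2_klPredsV16` is ACCEPTED (closes at birth): Jackson degree 2d ≤ 2^21·16^{nScales β} needs U ≤ U₅(G,Q); (E3c-TD) K-Lipschitz < 1 uniformly in volume on the capped class; smoothing error π⁶B₁/(d+1) + Σ_n CL β n/L₀ within tolerance, d before L.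
    sources: arXiv:math-ph/0001031 (FST IV inversion, CPAM 53 (2000) 1350), arXiv:cond-mat/0507686 §2 (2.23), (2.36), Mastropietro2005 Lemma 2 (Literature …FermiRG.Mastropietro2005: lemma2Statement_of_lipschitz), Salmhofer1998 (4.296), HOME/DECOMP.md App. C, App. D; HOME/prover-p4/INVERSION-NOTE.md; HOME/prover-p1b/U5-NOTE.md, STATUS l.739/741/749 (Δ13), Theorems/KLProgrammeDispersionFlowDefs.lean FrameGeometry
[crux] child 2 — the VOLUME-UNIFORM COUNTERTERM FIXED POINT (FST's inversion by successive
approximation in the counterterm scheme; Δ8 staging ∀ G ∀ P ∃ R ∀ Q ∃ c₁ > 0 ∀ c ≤ c₁ ∃ U₀ — R is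
chosen knowing only (G, P), so the engine's Q may depend on R): in the regime at (ν,U,β), ν ∈
klWindowC, and for ANY volume thresholds (Lh, Mh): IF for every admissible frame K and every L ≥ Lh,
M ≥ Mh L renormalisation of K below n (`RenormalisedAtF`: Fermi-curve mismatch ≤ cr|U|Λ_n²/e₀,
quadratic tolerance, no wave-function clause) yields the engine output `EngineBoundsAtV10S` (Δ15:
leg-dressing majorant `legDressBarQ2 G P Q U n c = Q.CR·((P.Klam·U)² + (P.Klam·|U|)³)·c`, Q chosen
after R), the two-leg step `TwoLegStepV16` (incl. the (E3f-A) all-volume rate) and the split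
`BetaSplitAtS2` at n (all n in the generic range — exactly what the glue's induction makes of
children 3 + 1), THEN there is ONE admissible frame K chosen BEFORE the volume (Δ1) and thresholds
(Lc, Mc) such that K is renormalised down to EVERY scale at every L ≥ Lc, M ≥ Mc L: the counterterm
map is a contraction of the DEGREE-CAPPED FrameOK ball into itself, uniformly in the volume. HISTORY
BY REFERENCE: Δ1–Δ24, F1, (R11) exact -/
@[route_item "route-HubbardSuperconductivity-KLProgramme"]
def KLRegimeCountertermV16 : Prop :=
  Summit.HubbardSuperconductivity.HubbardSuperconductivity.Theorems.KLRegimeSplit.CountertermP2 Summit.HubbardSuperconductivity.HubbardSuperconductivity.Theorems.KLRegimeSplit.klPredsV16 Summit.HubbardSuperconductivity.HubbardSuperconductivity.Theorems.KLRegimeSplit.klWindowC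

-- `KLRegimeCountertermV16` holds: proved by `Summit.HubbardSuperconductivity.HubbardSuperconductivity.Theorems.KLRegimeCounterterm.KLRegimeCountertermV16_of` (its module imports this route file, so no `_holds` link can be stated here).

-- parent: KLRegimeTwoPointLimit · child (gen 6)
/--     item stmt-HubbardSuperconductivity-20240 · crux · rank 205 · closed · proved by Summit.HubbardSuperconductivity.HubbardSuperconductivity.Theorems.TwoPointAssembly.KLRegimeTwoPointAssemblyV16_of (prover)
    parent: KLRegimeTwoPointLimit · by planner
    why it might fail: None in the statement: with the ∃-threshold slot it IS `twoPointAssemblyP3_ex klPredsV16 klWindowC` (G6a p475968 via p470883) and closes at birth; the content risk (L-uniform all-U Matsubara bound, covariance change at effAction level, index nScales β+1) moved to child 5 + the engine export.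
    sources: Theorems/KLProgrammeKLRegimeVolumeLimitExDefs.lean (G6a p475968: twoPointAssemblyP3_klPredsV12_ex), Theorems/KLProgrammeKLRegimeTwoPointAssemblySlotThreshold.lean (p470883), arXiv:cond-mat/0507686 §2.4, Lemmas 2.4–2.5, Literature/MathematicalPhysics/QuantumLattice/FermiRG/BGM2006Sec2TwoPoint.lean (Lemma24, Lemma25), Literature/MathematicalPhysics/QuantumLattice/HubbardTwoPointMatsubaraLimit.lean, HOME/t2/MATSUBARA-ALLU-SCOPE.md; HOME/hubbard-kl-r2d-p2/SKELETON-asm-repr.lean (stub_asm_matsubara/partition/frame/repr/volume); HOME/planner-g9/SPLIT-ARCH.md R6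
[crux] child 4 — TWO-POINT ASSEMBLY in one frame (BGM 2006 §2.4 / Lemma 2.5's role; Δ-asm-repaired
`TwoPointAssemblyP3`, hypothesis block `TowerP`): ∀ G P Q R ∀ c > 0 ∃ U₀: in the regime at (ν,U,β),
IF ONE admissible frame K (fixed before the volume) is renormalised, split, engine-bounded and
two-leg-controlled at every scale n ≤ nScales β + 1 (R1: the last slice is fully integrated) for all
L ≥ L⋆, M ≥ M⋆ L AND `FinalTwoLegVolLimitEx β U ν K M⋆` (the ∃-threshold slot, Δ-VL1 g11 l.1361, G6a
p475968) holds for THE SAME K (child 5's output, inside the ∃K hypothesis), THEN the finite-volume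
equal-time thermal two-point functions `hubbardThermalTwoPoint β U (ν + U/2) L x y σ σ'` (physical μ
= ν + U/2, Hartree shift Δ5) converge as L → ∞: Matsubara UV M → ∞ for every real U (t2:
`tendsto_grassmannTwoPoint_eq_hubbardThermalTwoPoint_sub_allU` line, `stub_asm_matsubara`) +
Gaussian change of covariance (C,V) ↔ (C_K,V_K) (`GrassmannGaussianMeasureChange`, `stub_asm_frame`)
+ source-shift representation G = C_K − C_K·𝒱₂·C_K (`GrassmannGaussianSourceShift`, landed
`gaussExpect_gen_mul_gen_mul` p447372, `stub_asm_repr`) + Riemann sums of the free part in the frame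
band e_K (`HubbardFreePropaga -/
@[route_item "route-HubbardSuperconductivity-KLProgramme"]
def KLRegimeTwoPointAssemblyV16 : Prop :=
  Summit.HubbardSuperconductivity.HubbardSuperconductivity.Theorems.KLRegimeSplit.TwoPointAssemblyP3 Summit.HubbardSuperconductivity.HubbardSuperconductivity.Theorems.KLRegimeSplit.klPredsV16 Summit.HubbardSuperconductivity.HubbardSuperconductivity.Theorems.KLRegimeSplit.FinalTwoLegVolLimitEx Summit.HubbardSuperconductivity.HubbardSuperconductivity.Theorems.KLRegimeSplit.klWindowC

-- `KLRegimeTwoPointAssemblyV16` holds: proved by `Summit.HubbardSuperconductivity.HubbardSuperconductivity.Theorems.TwoPointAssembly.KLRegimeTwoPointAssemblyV16_of` (its module imports this route file, so no `_holds` link can be stated here).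

-- parent: KLRegimeTwoPointLimit · child (gen 6)
/--     item stmt-HubbardSuperconductivity-20241 · support · rank 206 · closed · proved by Summit.HubbardSuperconductivity.HubbardSuperconductivity.Theorems.KLRegimeSplit.klRegimeTwoPointLimitGlueV16_holds (prover)
    parent: KLRegimeTwoPointLimit · by planner
KLRegimeEngineV16 → KLRegimeBetaSplitV16 → KLRegimeCountertermV16 → KLRegimeVolumeLimitV16 →
KLRegimeTwoPointAssemblyV16 → KLRegimeTwoPointLimit (proved downstream:
Summit.HubbardSuperconductivity.HubbardSuperconductivity.Theorems.KLRegimeSplit.KLRegimeInductionV16P4Ex;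
1-line closer to be landed in a Theorems module --workitem <this glue item>) -/
@[route_item "route-HubbardSuperconductivity-KLProgramme"]
def KLRegimeTwoPointLimitGlueV16 : Prop :=
  KLRegimeEngineV16 → KLRegimeBetaSplitV16 → KLRegimeCountertermV16 → KLRegimeVolumeLimitV16 → KLRegimeTwoPointAssemblyV16 → KLRegimeTwoPointLimit

-- `KLRegimeTwoPointLimitGlueV16` holds: proved by `Summit.HubbardSuperconductivity.HubbardSuperconductivity.Theorems.KLRegimeSplit.klRegimeTwoPointLimitGlueV16_holds` (its module imports this route file, so no `_holds` link can be stated here).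

-- parent: KLRegimeTwoPointLimit · child (gen 7)
/--     item stmt-HubbardSuperconductivity-20372 · crux · rank 205 · closed · proved by Summit.HubbardSuperconductivity.HubbardSuperconductivity.Theorems.TwoPointAssembly.KLRegimeTwoPointAssemblyV17F_of (prover)
    parent: KLRegimeTwoPointLimit · by planner
    why it might fail: None in the statement (closes at birth by the Pr-universal twoPointAssemblyP3_ex); the content risk (L-uniform Matsubara bound, index nScales β+1) lives in child 5 and the engine export.
    sources: Theorems/KLProgrammeKLRegimeVolumeLimitExDefs.lean (twoPointAssemblyP3_ex), Theorems/KLProgrammeKLRegimeTwoPointAssemblySlotThreshold.lean, arXiv:cond-mat/0507686 §2.4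
[crux] child 4 (gen 7-flow) — TWO-POINT ASSEMBLY at the dummy frame K = 0 (TowerP hypothesis block +
FinalTwoLegVolLimitEx for the same K): the finite-volume equal-time thermal two-point functions
converge as L → ∞ — Matsubara UV M → ∞ + (trivial at K = 0) Gaussian frame change + source-shift
representation + Riemann sums of the free part; with the ∃-threshold slot it IS
twoPointAssemblyP3_ex klPredsV17F klWindowC and CLOSES AT BIRTH (p2 draft v2 §8
`twoPointAssemblyTextV17F_holds`, k3c3-p2 S2 file). -/
@[route_item "route-HubbardSuperconductivity-KLProgramme"]
def KLRegimeTwoPointAssemblyV17F : Prop :=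
  Summit.HubbardSuperconductivity.HubbardSuperconductivity.Theorems.KLRegimeSplit.TwoPointAssemblyP3 Summit.HubbardSuperconductivity.HubbardSuperconductivity.Theorems.KLRegimeSplit.klPredsV17F Summit.HubbardSuperconductivity.HubbardSuperconductivity.Theorems.KLRegimeSplit.FinalTwoLegVolLimitEx Summit.HubbardSuperconductivity.HubbardSuperconductivity.Theorems.KLRegimeSplit.klWindowC

-- `KLRegimeTwoPointAssemblyV17F` holds: proved by `Summit.HubbardSuperconductivity.HubbardSuperconductivity.Theorems.TwoPointAssembly.KLRegimeTwoPointAssemblyV17F_of` (its module imports this route file, so no `_holds` link can be stated here).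

-- parent: KLRegimeTwoPointLimit · child (gen 8)
/--     item stmt-HubbardSuperconductivity-20437 · crux · rank 201 · open
    parent: KLRegimeTwoPointLimit · by planner
    why it might fail: One-shot tower at the tuned-to-(n−1) frame K_n must re-derive ALL levels j ≤ n, internal readings δ_j[K_n] controlled only via history at K_j + scale-j frame-shift VALUE response; k ≤ 4 reading jets at K_n need the |h|-free C4a law (j = 2) + tube laws; flowing sector count needs piece rate κ ≤ 1/32.
    sources: arXiv:cond-mat/0507686 §2 (2.23), (2.36), Thm 3.1 (3.3), DisertoriRivasseau2000, FeldmanSalmhoferTrubowitz1996, HOME/p2-g10/SCHEME-FLOW-VS-CT-p2g10.md, HOME/planner-g15/K3-FLOW-PRICING.md, HOME/hubbard-kl-k3c3-p3/MS-TRANSPORT.md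
[crux] child 3 (gen 8 = gen 7-flow on the CURED bundle klPredsV17F2: (E2-F) array bare-truncated,
cure 1 of k3c2-p2 KL l.2646 / T2-2 l.2649; p2 module …SplitSlotsV17F2) — the ENGINE in BGM 2006's
FLOWING-DISPERSION scheme (K3-FLOW RULING, KL STATUS l.2548; scheme F-II, one-shot carriers): ∃ G ∀
P ∃ Q ∀ R ∀ c ≤ c₃ ∃ U₀ L₃ M₃: for μ ∈ klWindowC, 0 < U ≤ U₀, klBetaMin ≤ β ≤ e^{c/U²}, the DUMMY
frame K = 0 (frameOK := K = 0 ∧ FrameOK), L ≥ L₃ β U, M ≥ M₃ β U L and every scale n ≤ nScales β + 1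
in the KL regime: the history HistP klPredsV17F … n (split, renorm-flow incl. the flow pieces' jets
and geometry, engine bounds, two-leg step at all j < n — hence the flow frame K_n = −Σ_{m<n} piece_m
is an admissible frame) ⟹ EngineBoundsAtV17F n (the V10S conjuncts for the ONE-SHOT effective action
at frame K_n: (E0) symmetry, (E1-v4) anisotropic-sector kernel norms at (K_n, n), (E2-F) one
Cooper-ladder step per scale CROSS-FRAME ((K_n, n) vs (K_{n−1}, n−1), bare-frame ball klBall L μ 0,
flowing slice count legSliceCountT … (K_n) n, + frameShiftBar P Q U n = Q.CR·(P.Klam·U)²·4^{−n}),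
(E2″-F)/(E2′-F) value increments cross-frame, (E2′-F uv), (E4) first moments at K_n, (E5-F)) ∧
TwoLegStepV17F n -/
@[route_item "route-HubbardSuperconductivity-KLProgramme"]
def KLRegimeEngineV17F2 : Prop :=
  Summit.HubbardSuperconductivity.HubbardSuperconductivity.Theorems.KLRegimeSplit.EngineP4 Summit.HubbardSuperconductivity.HubbardSuperconductivity.Theorems.KLRegimeSplit.klPredsV17F2 Summit.HubbardSuperconductivity.HubbardSuperconductivity.Theorems.KLRegimeSplit.klWindowC

-- parent: KLRegimeTwoPointLimit · child (gen 8)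
/--     item stmt-HubbardSuperconductivity-20438 · crux · rank 202 · closed · proved by Summit.HubbardSuperconductivity.HubbardSuperconductivity.Theorems.klRegimeBetaSplitV17F2_proof (prover)
    parent: KLRegimeTwoPointLimit · by planner
    why it might fail: V16 closer is same-K-essential in 3 places (array increment, endpoint line, envelope step): under F-II each compares (K_n, n) vs (K_{n−1}, n−1) and must absorb the frame shift in the Q.CR tolerance + frameShiftBar = Q.CR·(Klam U)²·4^{−n}; fails if the true shift is n-uniform U²Λ_{n−1}-sized.
    sources: HOME/hubbard-kl-k3c1-p2/CHILD1-FLOW-PORT.md, arXiv:cond-mat/0507686 §3 (3.65)–(3.70), FeldmanTrubowitz1991Flow Thm V.1, Theorems/KLProgrammeCooperChannelRiccatiFlowBlock.lean, Theorems/KLProgrammeKLRegimeSplitLegCountFlow.lean, HOME/DECOMP.md App. E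
[crux] child 1 (gen 8 = gen 7-flow on the CURED bundle klPredsV17F2: (E2-F) array bare-truncated,
cure 1 of k3c2-p2 KL l.2646 / T2-2 l.2649; p2 module …SplitSlotsV17F2) — the SIGN-RESOLVED BETA
SPLIT as one strong-induction step on the flowing-dispersion family: ∀ G ∃ P ∀ Q ∃ c₀ ∀ c ≤ c₀ ∀ R ∃
U₀ L₁ M₁: HistP klPredsV17F n + EngineBoundsAtV17F n + TwoLegStepV17F n ⟹ BetaSplitAtV17F n =
PairArrayAtV17F ((B1-F): Cooper blocks of the localised quartic part at (K_n, n) inside C2's Riccati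
envelopes, amplitude array read on the bare-frame ball, tolerance (P.C_W +
klLegKappa·Q.CR·P.Klam³)·U² — the cross-frame ladder's Σ_n frameShiftBar ≤ (4/3)·Q.CR·(Klam U)² sits
inside this existing token, sum_frameShiftBar_le) ∧ (EndpointNormLineIso at K_n ∧
QuarticValueLineV17F on the bare ball) ∧ FirstMoments at K_n. Port of the closed gen-6 child 20237
(betaSplitP_of_slotsV10S): carriers cross-frame, interleaving of the frame shift
(CHILD1-FLOW-PORT.md v2 §4/§6, conditions (α)–(ε); kernel legSliceCountT_flow_sum_le p521177). -/
@[route_item "route-HubbardSuperconductivity-KLProgramme"]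
def KLRegimeBetaSplitV17F2 : Prop :=
  Summit.HubbardSuperconductivity.HubbardSuperconductivity.Theorems.KLRegimeSplit.BetaSplitP Summit.HubbardSuperconductivity.HubbardSuperconductivity.Theorems.KLRegimeSplit.klPredsV17F2 Summit.HubbardSuperconductivity.HubbardSuperconductivity.Theorems.KLRegimeSplit.klWindowC

-- `KLRegimeBetaSplitV17F2` holds: proved by `Summit.HubbardSuperconductivity.HubbardSuperconductivity.Theorems.klRegimeBetaSplitV17F2_proof` (its module imports this route file, so no `_holds` link can be stated here).

-- parent: KLRegimeTwoPointLimit · child (gen 8)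
/--     item stmt-HubbardSuperconductivity-20439 · crux · rank 203 · closed · proved by Summit.HubbardSuperconductivity.HubbardSuperconductivity.Theorems.KLRegimeSplit.countertermP2_klPredsV17F2_holds (prover)
    parent: KLRegimeTwoPointLimit · by planner
    why it might fail: Package fits only (cr ≥ 32(S₀+S′₀U₀), Gfr_j ≥ Jackson/cutoff numerals × max_i(S_i+S′_iU₀), c₁(R) from (n+1)·Gfr₂U² ≤ 1/100): fails if the engine's S-tables force Gfr beyond what the engine's own U₀(R) staging tolerates — circularity G→P→R→Q→U₀ must close (closer 5d11b540f0641cee says it does).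
    sources: arXiv:cond-mat/0507686 §2 (2.23) Lemma 2.1, HOME/hubbard-kl-k3c3-p2/g6 (FlowPieceJackson.draft.lean 6c77e31fc711d39d), Theorems/KLProgrammeKLRegimeCountertermJacksonFrame.lean, Theorems/KLProgrammeKLRegimeCountertermJacksonFrameDeriv.lean, Theorems/KLProgrammeKLRegimeSplitStagePieces.lean (geomConstants_of_pieces), KL STATUS l.2556
[crux] child 2 (gen 8 = gen 7-flow on the CURED bundle klPredsV17F2: (E2-F) array bare-truncated,
cure 1 of k3c2-p2 KL l.2646 / T2-2 l.2649; p2 module …SplitSlotsV17F2) — the RENORMALISATION FLOW by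
FORWARD INDUCTION (replaces the volume-uniform counterterm fixed point of gen 2–6: no inversion, no
contraction, no degree-capped class): ∀ G ∀ P ∃ R ∀ Q ∃ c₁ ∀ c ≤ c₁ ∃ U₀: IF at the dummy frame K =
0 the history up to n yields engine ∧ two-leg ∧ split at n for all large L, M (what the glue's
induction makes of children 3 + 1), THEN K = 0 is frameOK (klPredsV17F_frameOK_zeroC) and
RenormFlowAtV17F … R n holds at every n ≤ n_β: RenormalisedAtF at (K_n, n) (the cumulative reading
has increment size: cr ≥ 32(S₀+S′₀U₀)) ∧ FlowPieceJetsAt n (the CONSTRUCTED piece piece_n =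
jacksonFrame (klFlowDeg n = 2⁷·4ⁿ) (klFrameExtFn μ ν_n(K_n)) has admissible jets ‖Dʲ‖ ≤ Gfr j·uPow j
U·4^{(j−2)n}, j ≤ 4, from (E3a-F)'s reading jets by Jackson–Bernstein (J2) and the tube extension,
D₄ symmetry of the reading) ∧ FlowGeometryAt n (Lemma-2.1 geometry of ε − μ − K_{n+1} by
geomConstants_of_pieces and the three low-order sums; c ≤ c₁(R) ≍ ln4/(300·Gfr₂)). Each volume
separately (frames are per volume, PF-1). -/
@[route_item "route-HubbardSuperconductivity-KLProgramme"]
def KLRegimeRenormFlowV17F2 : Prop :=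
  Summit.HubbardSuperconductivity.HubbardSuperconductivity.Theorems.KLRegimeSplit.CountertermP2 Summit.HubbardSuperconductivity.HubbardSuperconductivity.Theorems.KLRegimeSplit.klPredsV17F2 Summit.HubbardSuperconductivity.HubbardSuperconductivity.Theorems.KLRegimeSplit.klWindowC

/-- `KLRegimeRenormFlowV17F2` holds: proved by `Summit.HubbardSuperconductivity.HubbardSuperconductivity.Theorems.KLRegimeSplit.countertermP2_klPredsV17F2_holds`. -/
theorem KLRegimeRenormFlowV17F2_holds : KLRegimeRenormFlowV17F2 := _root_.Summit.HubbardSuperconductivity.HubbardSuperconductivity.Theorems.KLRegimeSplit.countertermP2_klPredsV17F2_holds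

-- parent: KLRegimeTwoPointLimit · child (gen 8)
/--     item stmt-HubbardSuperconductivity-20441 · crux · rank 205 · closed · proved by Summit.HubbardSuperconductivity.HubbardSuperconductivity.Theorems.TwoPointAssembly.KLRegimeTwoPointAssemblyV17F2_of (prover)
    parent: KLRegimeTwoPointLimit · by planner
    why it might fail: None in the statement (closes at birth by the Pr-universal twoPointAssemblyP3_ex); the content risk (L-uniform Matsubara bound, index nScales β+1) lives in child 5 and the engine export.
    sources: Theorems/KLProgrammeKLRegimeVolumeLimitExDefs.lean (twoPointAssemblyP3_ex), Theorems/KLProgrammeKLRegimeTwoPointAssemblySlotThreshold.lean, arXiv:cond-mat/0507686 §2.4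
[crux] child 4 (gen 8 = gen 7-flow on the CURED bundle klPredsV17F2: (E2-F) array bare-truncated,
cure 1 of k3c2-p2 KL l.2646 / T2-2 l.2649; p2 module …SplitSlotsV17F2) — TWO-POINT ASSEMBLY at the
dummy frame K = 0 (TowerP hypothesis block + FinalTwoLegVolLimitEx for the same K): the
finite-volume equal-time thermal two-point functions converge as L → ∞ — Matsubara UV M → ∞ +
(trivial at K = 0) Gaussian frame change + source-shift representation + Riemann sums of the free
part; with the ∃-threshold slot it IS twoPointAssemblyP3_ex klPredsV17F klWindowC and CLOSES AT
BIRTH (p2 draft v2 §8 `twoPointAssemblyTextV17F_holds`, k3c3-p2 S2 file). -/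
@[route_item "route-HubbardSuperconductivity-KLProgramme"]
def KLRegimeTwoPointAssemblyV17F2 : Prop :=
  Summit.HubbardSuperconductivity.HubbardSuperconductivity.Theorems.KLRegimeSplit.TwoPointAssemblyP3 Summit.HubbardSuperconductivity.HubbardSuperconductivity.Theorems.KLRegimeSplit.klPredsV17F2 Summit.HubbardSuperconductivity.HubbardSuperconductivity.Theorems.KLRegimeSplit.FinalTwoLegVolLimitEx Summit.HubbardSuperconductivity.HubbardSuperconductivity.Theorems.KLRegimeSplit.klWindowC

-- `KLRegimeTwoPointAssemblyV17F2` holds: proved by `Summit.HubbardSuperconductivity.HubbardSuperconductivity.Theorems.TwoPointAssembly.KLRegimeTwoPointAssemblyV17F2_of` (its module imports this route file, so no `_holds` link can be stated here).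

-- parent: KLRegimeTwoPointLimit · child (gen 8)
/--     item stmt-HubbardSuperconductivity-20440 · aside · rank 204 · open
    parent: KLRegimeTwoPointLimit · by planner
    why it might fail: Each volume has its OWN flow-frame sequence K_n^{(L)}: needs the frames' L-dependence to converge at rate CL β n/L (TwoLegVolumeRateF) for NESTED same-point comparability, plus the L-uniform site-moment modulus at β ~ e^{c/U²} — expansion content, no U-power series (summable_cooperChain_neg_iff).
    sources: Theorems/KLProgrammeKLRegimeVolumeLimitExDefs.lean (FinalTwoLegVolLimitEx, volumeLimitP2_ex_of), Theorems/KLProgrammeKLRegimeVolumeLimitDyson.lean, arXiv:cond-mat/0507686 §2.4 (2.38), Lemmas 2.4–2.5, Literature/MathematicalPhysics/QuantumLattice/FermiRG/BGM2006Sec2TwoPoint.lean, KL STATUS l.2464/2495 (k3c5-p3 Q-F4), l.2547 (p2 §8 design note)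
[crux] child 5 (gen 8 = gen 7-flow on the CURED bundle klPredsV17F2: (E2-F) array bare-truncated,
cure 1 of k3c2-p2 KL l.2646 / T2-2 l.2649; p2 module …SplitSlotsV17F2) — TERMWISE THERMODYNAMIC
LIMIT of the last-scale two-leg kernel at the DUMMY frame K = 0 (BGM 2006 (2.38)/Lemma 2.4's role):
∀ G P Q R ∃ c₅ ∀ c ≤ c₅ ∃ U₀: IF K = 0 is renorm-flowed, split, engine-bounded and
two-leg-controlled at every n ≤ nScales β + 1 for all L ≥ L⋆, M ≥ M⋆ L, THEN FinalTwoLegVolLimitEx β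
U ν 0 M⋆ — the volume limit of klSelfEnergy … 0 klE0 (nScales β+1) (the BARE-bracketing last-scale
object, frame-FREE), owed from the flow tower by the all-degree quadratic-insertion algebra
(effAction_sub_quadratic p520617, HubbardDiagonalQuadraticResummation p521577) + the flow frames'
own two-volume rates (E3f-F); Cauchy two-volume route «cauchy v7» (k3c5-p3; stub_vl_nested twin),
framed doors instantiate verbatim under frameOK := K = 0 ∧ FrameOK. -/
@[route_item "route-HubbardSuperconductivity-KLProgramme"]
def KLRegimeVolumeLimitV17F2 : Prop :=
  Summit.HubbardSuperconductivity.HubbardSuperconductivity.Theorems.KLRegimeSplit.VolumeLimitP2 Summit.HubbardSuperconductivity.HubbardSuperconductivity.Theorems.KLRegimeSplit.klPredsV17F2 Summit.HubbardSuperconductivity.HubbardSuperconductivity.Theorems.KLRegimeSplit.FinalTwoLegVolLimitEx Summit.HubbardSuperconductivity.HubbardSuperconductivity.Theorems.KLRegimeSplit.klWindowC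

-- parent: KLRegimeTwoPointLimit · glue (gen 8)
/--     item stmt-HubbardSuperconductivity-20442 · support · rank 206 · closed · proved by Summit.HubbardSuperconductivity.HubbardSuperconductivity.Theorems.KLRegimeSplit.klRegimeTwoPointLimitGlueV17F2_holds (prover)
    parent: KLRegimeTwoPointLimit · GLUE: children ⟹ parent · by planner
KLRegimeEngineV17F2 → KLRegimeBetaSplitV17F2 → KLRegimeRenormFlowV17F2 → KLRegimeVolumeLimitV17F2 →
KLRegimeTwoPointAssemblyV17F2 → KLRegimeTwoPointLimit (proved downstream:
Summit.HubbardSuperconductivity.HubbardSuperconductivity.Theorems.KLRegimeSplit.KLRegimeTwoPointLimit_of_V17F2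
= KLRegimeInductionP4 klPredsV17F2 FinalTwoLegVolLimitEx; 1-line closer to be landed in a Theorems
module --workitem <this glue item>) -/
@[route_item "route-HubbardSuperconductivity-KLProgramme"]
def KLRegimeTwoPointLimitGlueV17F2 : Prop :=
  KLRegimeEngineV17F2 → KLRegimeBetaSplitV17F2 → KLRegimeRenormFlowV17F2 → KLRegimeVolumeLimitV17F2 → KLRegimeTwoPointAssemblyV17F2 → KLRegimeTwoPointLimit

-- `KLRegimeTwoPointLimitGlueV17F2` holds: proved by `Summit.HubbardSuperconductivity.HubbardSuperconductivity.Theorems.KLRegimeSplit.klRegimeTwoPointLimitGlueV17F2_holds` (its module imports this route file, so no `_holds` link can be stated here).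

/-- item stmt-HubbardSuperconductivity-19938 · crux · rank 3 · open · by planner
why it might fail: Thm 2.1-type bounds at |h| ≤ a/U on the window must run on the one-determined-leg count (V) alone — the (L−3)/2 two-leg exponent FAILS at corner classes (kit j250534); the T>0 μ-inversion is an implicit-function step announced (PS03 Thm p.4; thesis 2005 unpublished), not in print on the window.
sources: BenfattoGiulianiMastropietro2006, DisertoriRivasseau2000, Salmhofer1998, arXiv:2109.02135, arXiv:2303.13628, paper:url-421309f0fec9
[crux] K1 — there are U₀, a > 0 such that for δ ∈ [0.10, 0.35], 0 < U ≤ U₀ and 0 < β ≤ e^{a/U} the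
same two-point functions converge as L → ∞: the Benfatto–Giuliani–Mastropietro theorem (whose
published μ-range −4 < μ < −2−√2 excludes the window) at intermediate filling, sign-blind, momentum
conserved modulo 2πℤ² (DECOMP C5a = Paper 1 = H1.0). [difficulty: L] -/
@[route_item "route-HubbardSuperconductivity-KLProgramme"]
def H10TwoPointLimit : Prop :=
  ∃ U₀ a : ℝ, 0 < U₀ ∧ 0 < a ∧ ∀ δ ∈ Set.Icc (0.10 : ℝ) 0.35, ∀ U β : ℝ, 0 < U → U ≤ U₀ → 0 < β → β ≤ Real.exp (a / U) → ∀ (x y : Literature.Probability.LatticeModels.Site 2) (σ σ' : Fin 2), ∃ S : ℂ, Filter.Tendsto (fun L : ℕ => Literature.MathematicalPhysics.QuantumLattice.hubbardThermalTwoPoint β U (Literature.MathematicalPhysics.QuantumLattice.chemicalPotentialOfDensity (Literature.MathematicalPhysics.QuantumLattice.squareDispersion 1 0) (1 - δ)) L x y σ σ') Filter.atTop (nhds S)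

/-- item stmt-HubbardSuperconductivity-23356 · crux · rank 204 · open · by planner
why it might fail: Each volume has its OWN flow-frame sequence K_n^{(L)}: needs the frames' L-dependence to converge at rate CL β n/L (TwoLegVolumeRateF) for NESTED same-point comparability, plus the L-uniform site-moment modulus at β ~ e^{c/U²} — expansion content, no U-power series; R.WF2 re-keys the doors only.
sources: Theorems/KLProgrammeKLRegimeSplitGenericV5.lean (VolumeLimitP3, volumeLimitP3_of_volumeLimitP2, k3_twoPointLimit_of_childrenP5; p662771), Theorems/KLProgrammeKLRegimeVolumeLimitFlowFramesV17F3.lean (volumeLimitTextV17F3_of_framedNestedFlowText; p663063), Theorems/KLProgrammeKLRegimeVolumeLimitExDefs.lean (FinalTwoLegVolLimitEx, volumeLimitP2_ex_of), Theorems/KLProgrammeKLRegimeVolumeLimitDyson.lean, arXiv:cond-mat/0507686 §2.4 (2.38), Lemmas 2.4–2.5, BenfattoGiulianiMastropietro2006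
[crux] child 5 v3 = gen-8 child 5 (stmt-HubbardSuperconductivity-20440 `KLRegimeVolumeLimitV17F2`,
VolumeLimitP2) RE-KEYED under the renormalisation-package binder `R.WF2` (positive tolerances cr,
cz) in place of `R.WF` — located seam «VL-R-WF2» (KL STATUS (R224) l.8102, FREEZE v8.30 l.9264):
every engine-side door the volume-limit data stub consumes
(scaleCovData_/scaleCovSecData_klStepCov_flow_all, transferWtData_klTowerTransfer_flow_all, the
scale-0 doors) is stated under R.WF2, as EngineP4 itself is, and neither R.WF ⇒ R.WF2 nor TowerP_R ⇒
TowerP_{R⁺} holds (the two-leg slot's volume-rate clause is contravariant in R); the K3 glue never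
needed the weaker binder (inductionP4 obtains R from child 2 WITH R.WF2). CONTENT UNCHANGED:
TERMWISE THERMODYNAMIC LIMIT of the last-scale two-leg kernel at the dummy frame K = 0 on the cured
bundle klPredsV17F2 (BGM 2006 (2.38)/Lemma 2.4's role): ∀ G P Q R, R.WF2 → ∃ c₅ > 0 ∀ 0 < c ≤ c₅ ∃
U₀: IF K = 0 is renorm-flowed, split, engine-bounded and two-leg-controlled at every n ≤ nScales β +
1 for all L ≥ L⋆, M ≥ M⋆ L, THEN FinalTwoLegVolLimitEx β U ν 0 M⋆ (volume limit of the
bare-bracketing, frame-free last-scale object), owed from the flow towe -/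
@[route_item "route-HubbardSuperconductivity-KLProgramme"]
def KLRegimeVolumeLimitV17F3 : Prop :=
  Summit.HubbardSuperconductivity.HubbardSuperconductivity.Theorems.KLRegimeSplit.VolumeLimitP3 Summit.HubbardSuperconductivity.HubbardSuperconductivity.Theorems.KLRegimeSplit.klPredsV17F2 Summit.HubbardSuperconductivity.HubbardSuperconductivity.Theorems.KLRegimeSplit.FinalTwoLegVolLimitEx Summit.HubbardSuperconductivity.HubbardSuperconductivity.Theorems.KLRegimeSplit.klWindowC

/-- item stmt-HubbardSuperconductivity-19939 · support · rank 9 · closed · proved by Summit.HubbardSuperconductivity.HubbardSuperconductivity.Theorems.muOfDopingWindow_proof (prover) · by planner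
sources: KohnLuttinger1965
[support] S0 — the free-band chemical potentials of the doping window lie in the analysis window:
μ(δ) ∈ [−1, −0.15] for δ ∈ [0.10, 0.35] (two certified quadratures of `filling` + monotonicity + the
`sInf` characterisation). It is the second named stub of BOTH cruxes' registered birth skeletons
(`H10TwoPointLimit_of : H10TwoPointLimitMu (−1) (−0.15) → MuOfDopingWindow → K1`,
`KLRegimeTwoPointLimit_of : … → K3`, compositions proved), so provers work in the μ-parametrisation.
[difficulty: provable-now] -/
@[route_item "route-HubbardSuperconductivity-KLProgramme"]
def MuOfDopingWindow : Prop :=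
  ∀ δ ∈ Set.Icc (0.10 : ℝ) 0.35, Literature.MathematicalPhysics.QuantumLattice.chemicalPotentialOfDensity (Literature.MathematicalPhysics.QuantumLattice.squareDispersion 1 0) (1 - δ) ∈ Set.Icc (-1 : ℝ) (-0.15)

/-- `MuOfDopingWindow` holds: proved by `Summit.HubbardSuperconductivity.HubbardSuperconductivity.Theorems.muOfDopingWindow_proof`. -/
theorem MuOfDopingWindow_holds : MuOfDopingWindow := _root_.Summit.HubbardSuperconductivity.HubbardSuperconductivity.Theorems.muOfDopingWindow_proof

/-- item stmt-HubbardSuperconductivity-20034 · support · rank 9 · closed · proved by Summit.HubbardSuperconductivity.HubbardSuperconductivity.Theorems.H10RungCompactBox_proof (prover) · by planner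
[support] BC5 FIRST RUNG of crux H10TwoPointLimit (K1), plan-only (T3): the COMPACT-BOX corner of K1
made uniform on the doping window — for every B > 0 there is U₀(B) > 0 with the two-point
thermodynamic limit for all δ ∈ [0.10, 0.35], 0 < U ≤ U₀, 0 < β ≤ B. Not in the tree (the tree has
the corner only pointwise in (β, μ): hubbardTwoPoint_limit_exists_of_small_coupling; plus the HT
strip β ≤ betaHT). Technique: single-scale chain tendsto_hubbardThermalTwoPoint_of_truncated_bounds
+ exists_norm_hubbardTorusTruncatedCoeff_le_geometric with C(β, μ), S(β, μ) bounded uniformly on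
[betaHT, B] × [−1, −0.15] (MuOfDopingWindow places μ(δ)). 3–6 sd, provable now; special case of K1
(H10RungCompactBox_of_H10 proved in K1's skeleton). Source: REF-CHECK §13 FINDING-1 (option α);
DECOMP §8(f). -/
@[route_item "route-HubbardSuperconductivity-KLProgramme"]
def H10RungCompactBox : Prop :=
  ∀ B : ℝ, 0 < B → ∃ U₀ : ℝ, 0 < U₀ ∧ ∀ δ ∈ Set.Icc (0.10 : ℝ) 0.35, ∀ U β : ℝ, 0 < U → U ≤ U₀ → 0 < β → β ≤ B → ∀ (x y : Literature.Probability.LatticeModels.Site 2) (σ σ' : Fin 2), ∃ S : ℂ, Filter.Tendsto (fun L : ℕ => Literature.MathematicalPhysics.QuantumLattice.hubbardThermalTwoPoint β U (Literature.MathematicalPhysics.QuantumLattice.chemicalPotentialOfDensity (Literature.MathematicalPhysics.QuantumLattice.squareDispersion 1 0) (1 - δ)) L x y σ σ') Filter.atTop (nhds S)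

-- `H10RungCompactBox` holds: proved by `Summit.HubbardSuperconductivity.HubbardSuperconductivity.Theorems.H10RungCompactBox_proof` (its module imports this route file, so no `_holds` link can be stated here).

/-- item stmt-HubbardSuperconductivity-20035 · support · rank 9 · closed · proved by Summit.HubbardSuperconductivity.HubbardSuperconductivity.Theorems.H10RungBetaUCorner_of (prover) · by planner
[support] BC5 SECOND RUNG of crux H10TwoPointLimit (K1), plan-only: the βU-CORNER of K1 made uniform
on the doping window — ∃ U₀ κ > 0, ∀ δ ∈ [0.10, 0.35], 0 < U ≤ U₀, β > 0, β·U ≤ κ → the two-point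
thermodynamic limit exists. Not in the tree and NOT reachable by the single-scale engine (its radius
is ∝ (β·C(β, μ)·S)⁻¹ with C ≳ β^{5/2}; REF-CHECK §13 FINDING-1): needs a multiscale resummation of
the frequency axis (isotropic, sector-free Gallavotti–Nicolò tree expansion down to scale 1/β — βU ≤
κ keeps the running couplings O(κ); equivalently the C5a engine in the sub-regime U·log β → 0).
12–20 sd (re-priced in DECOMP v6 from 3–6); special case of K1 (κ := a; H10RungBetaUCorner_of_H10
proved in K1's skeleton). Sources: BenfattoGiulianiMastropietro2006 §2–3; DECOMP §8(f). -/
@[route_item "route-HubbardSuperconductivity-KLProgramme"]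
def H10RungBetaUCorner : Prop :=
  ∃ U₀ κ : ℝ, 0 < U₀ ∧ 0 < κ ∧ ∀ δ ∈ Set.Icc (0.10 : ℝ) 0.35, ∀ U β : ℝ, 0 < U → U ≤ U₀ → 0 < β → β * U ≤ κ → ∀ (x y : Literature.Probability.LatticeModels.Site 2) (σ σ' : Fin 2), ∃ S : ℂ, Filter.Tendsto (fun L : ℕ => Literature.MathematicalPhysics.QuantumLattice.hubbardThermalTwoPoint β U (Literature.MathematicalPhysics.QuantumLattice.chemicalPotentialOfDensity (Literature.MathematicalPhysics.QuantumLattice.squareDispersion 1 0) (1 - δ)) L x y σ σ') Filter.atTop (nhds S)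

-- `H10RungBetaUCorner` holds: proved by `Summit.HubbardSuperconductivity.HubbardSuperconductivity.Theorems.H10RungBetaUCorner_of` (its module imports this route file, so no `_holds` link can be stated here).

/-- item stmt-HubbardSuperconductivity-20036 · support · rank 9 · closed · proved by Summit.HubbardSuperconductivity.HubbardSuperconductivity.Theorems.CountPairsOffset_proof (prover) · by planner
[support] S5 of DECOMP (App. F Lemma F.1): the ARBITRARY-OFFSET pair count on the Hubbard band,
uniform in the offset P — the number of grid pairs (θ₂, θ₃) with |ε(P + p(θ₂) + p(θ₃)) − μ| ≤ Cδ·w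
is ≤ Kp·(J + 2 + log N)/w, uniformly for μ in compact windows of (−4, 0) and all offsets P ∈ ℝ²; =
the 2n-leg sector count modulo 2πℤ² (Cor. F.3) = C5a(i) formalisable piece = Lemma E.5's
two-constraint input. At P = p(θ₁) it is the tree's fixed-first-point shape (count_pairs_exists;
countPairs_of_offset proved in HOME/planner-g5/S5Sketch.lean). Proof plan App. F F.2: bulk/diagonal
= mechanical re-proofs of the landed toolbox (HubbardBandSectorCountingToolbox/Bounds/Counts); new:
hodograph transversal + quadratic fold + cubic fold gridCount_L6 + jet dichotomy. 10–14 sd;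
deliverable Literature/MathematicalPhysics/QuantumLattice/HubbardBandSectorCountingOffset.lean
[folklore]. Sources: BenfattoGiulianiMastropietro2006 App. A2 / Lemma 3.1; tree count_pairs_exists. -/
@[route_item "route-HubbardSuperconductivity-KLProgramme"]
def CountPairsOffset : Prop :=
  ∀ a b : ℝ, -4 < a → a ≤ b → b < 0 → ∀ η₀ Cδ : ℝ, 0 < η₀ → 0 < Cδ → ∃ Kp : ℝ, 0 < Kp ∧ ∀ μ : ℝ, μ ∈ Set.Icc a b → a ≤ μ - η₀ → μ + η₀ ≤ b → ∀ (P : ℝ × ℝ) (w : ℝ) (N Nh J : ℕ), 0 < w → w ≤ 1 → (N : ℝ) * w = 2 * Real.pi → (Nh : ℝ) * w = Real.pi → N = 2 * Nh → (2 : ℝ) ^ J * w = Real.pi → Cδ * w ≤ η₀ / 2 → ((((Finset.range N ×ˢ Finset.range N).filter fun p : ℕ × ℕ => |Literature.MathematicalPhysics.QuantumLattice.BandSectorCounting.eps2 (P.1 + Literature.MathematicalPhysics.QuantumLattice.bandX μ (w / 2 + p.1 * w) + Literature.MathematicalPhysics.QuantumLattice.bandX μ (w / 2 + p.2 * w)) (P.2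 + Literature.MathematicalPhysics.QuantumLattice.bandY μ (w / 2 + p.1 * w) + Literature.MathematicalPhysics.QuantumLattice.bandY μ (w / 2 + p.2 * w)) - μ| ≤ Cδ * w).card : ℝ)) ≤ Kp * ((J : ℝ) + 2 + Real.log N) / w

-- `CountPairsOffset` holds: proved by `Summit.HubbardSuperconductivity.HubbardSuperconductivity.Theorems.CountPairsOffset_proof` (its module imports this route file, so no `_holds` link can be stated here).

/-- item stmt-HubbardSuperconductivity-19940 · assembly · rank 1 · closed · proved by Summit.HubbardSuperconductivity.HubbardSuperconductivity.Theorems.KLProgramme_Assembly_proof (prover) · by planner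
sources: BenfattoGiulianiMastropietro2006
[assembly] K3 → K1 → the rung-R2d leaf H1TwoPointLimitKLScaleD (β-case split; pure logic). -/
@[route_item "route-HubbardSuperconductivity-KLProgramme"]
def Assembly : Prop :=
  KLRegimeTwoPointLimit → H10TwoPointLimit → Summit.HubbardSuperconductivity.HubbardSuperconductivity.Theses.WeakCouplingBCS.H1TwoPointLimitKLScaleD

-- `Assembly` holds: proved by `Summit.HubbardSuperconductivity.HubbardSuperconductivity.Theorems.KLProgramme_Assembly_proof` (its module imports this route file, so no `_holds` link can be stated here).

/-! D-0027 §2.1 — DECIDING THEOREM (planner-authored via `route open/edit --closes-file`; by planner-gate-hubbard-kl-plan-g24-0 2026-08-28T20:16:20Z):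
its hypotheses are this route's items and its conclusion the registered leaf `Summit.HubbardSuperconductivity.HubbardSuperconductivity.Theses.WeakCouplingBCS.H1TwoPointLimitKLScaleD` (rung R2dH1, D-0061) (glue_lint), and it elaborates with this file. -/

/-- **Deciding theorem of route KLProgramme** (D-0027 §2.1; closes_target = the rung-R2d leaf, D-0061): the β-regime split,
proved THROUGH the route's `Assembly` item so that the assembly decl is in the cone of `closes`.
Binders: K1 (`H10TwoPointLimit`: 0 < β ≤ e^{a/U}), the five gen-8 children of K3 — engine `KLRegimeEngineV17F2`, β-split
`KLRegimeBetaSplitV17F2`, renormalised flow `KLRegimeRenormFlowV17F2`, the RE-KEYED volume-limit child `KLRegimeVolumeLimitV17F3`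
(`VolumeLimitP3`, renormalisation package under `R.WF2`; GO VL STEP 2, pen g24) and the two-point assembly `KLRegimeTwoPointAssemblyV17F2` —
and the proved support `MuOfDopingWindow`.  K3 (`KLRegimeTwoPointLimit`: e^{a/U} ≤ β ≤ e^{c/U²} for every a > 0) is DERIVED inside from the
children by `KLRegimeSplit.k3_twoPointLimit_of_childrenP5` (Theorems/KLProgrammeKLRegimeSplitGenericV5.lean), then K3 + K1 give the leaf
`H1TwoPointLimitKLScaleD` (0 < β ≤ e^{c/U²}) on the doping window [0.10, 0.35] exactly as before.  Pure logic; load-bearing (open) binders: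
`H10TwoPointLimit`, `KLRegimeEngineV17F2`, `KLRegimeVolumeLimitV17F3`. -/
@[closes "route-HubbardSuperconductivity-KLProgramme"] theorem closes (h₁ : H10TwoPointLimit) (hμ : MuOfDopingWindow) (hE : KLRegimeEngineV17F2) (hB : KLRegimeBetaSplitV17F2)
    (hR : KLRegimeRenormFlowV17F2) (hV : KLRegimeVolumeLimitV17F3) (hT : KLRegimeTwoPointAssemblyV17F2) :
    Summit.HubbardSuperconductivity.HubbardSuperconductivity.Theses.WeakCouplingBCS.H1TwoPointLimitKLScaleD := by
  have h₃ : KLRegimeTwoPointLimit :=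
    Summit.HubbardSuperconductivity.HubbardSuperconductivity.Theorems.KLRegimeSplit.k3_twoPointLimit_of_childrenP5 hE hB hR hV hT hμ
  have hA : Assembly := by
    intro k₃ k₁
    obtain ⟨U₀, a, hU₀, ha, H1⟩ := k₁
    obtain ⟨U₁, c, hU₁, hc, H3⟩ := k₃ a ha
    refine ⟨min U₀ U₁, c, lt_min hU₀ hU₁, hc, ?_⟩
    intro δ hδ U β hU hUle hβ hβle x y σ σ'
    by_cases hcase : β ≤ Real.exp (a / U)
    · exact H1 δ hδ U β hU (le_trans hUle (min_le_left _ _)) hβ hcase x y σ σ'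
    · exact H3 δ hδ U β hU (le_trans hUle (min_le_right _ _)) (le_of_lt (not_le.mp hcase)) hβle x y σ σ'
  exact hA h₃ h₁

end Summit.HubbardSuperconductivity.HubbardSuperconductivity.Theses.KLProgramme
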